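import Literature.NumberTheory.EllipticCurves.KramerDescentSelmerTwoSpanProofs
import Literature.NumberTheory.EllipticCurves.KummerMap
import Mathlib.Topology.Piecewise
import HarnessLib

/-!
# Kramer's `2`-descent: the leaf `Kramer1983_shaG_of_selmerG` of `KramerDescent.lean` — PROVED

K. Kramer, *A family of semistable elliptic curves with large Tate–Shafarevitch groups*,
Proc. Amer. Math. Soc. **89** (1983), 379–386 [Kramer1983], §3 (diagram (4)), §4 (Remark),
§5 ((9)–(10), Lemma 3). `KramerDescent.lean` reduces the bound `dim Ш(B, ℚ)₂ ≥ 2n` for Kramer's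
family (`Kramer1983_twoRank_sha_family`, whence the barrier
`Literature.Barriers.BirchSwinnertonDyer.TwoDescentDefectUnbounded`) to three named leaves. The
third (`Kramer1983_selmerTwo_span`) is proved in `KramerDescentSelmerTwoSpanProofs`. This file
PROVES the second, the Galois-cohomological one,

* `Kramer1983_shaG_of_selmerG_holds : Kramer1983_shaG_of_selmerG` — for every `m > 0` a
  homomorphism `Ξ : ℚ*/ℚ*² → H¹(ℚ, B_m)` (the tree's continuous `H¹(Γ_ℚ, B(ℚ̄))`,
  `WeierstrassCurve.galH1`) with values killed by `2`, with `Ξ [d] = 0 ⟹ [d] ∈ γ(A_m(ℚ))`, and with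
  `Ξ [d]` in the local kernel `ker (H¹(ℚ, B) → H¹(ℚ_v, B))` (`localRestrictionKer`, file `Sha`)
  at every finite or infinite place `v` at which `[d]_v ∈ γ_v(A_m(ℚ_v))`,

so that `Kramer1983_twoRank_sha_family`, and with it the barrier, rests on the single remaining
leaf `Kramer1983_selmerG_generators_local` (Lemma 2 with the Remark of §4 over the completions:
`-1` and the primes of `𝔏 ∪ 𝔐` lie in every `γ_v(A(ℚ_v))`):
`Kramer1983_twoRank_sha_family_of_generators_local`.

## The mathematics (Kramer §3, §5; Silverman X.4)

`A = A_m : y² + xy = x³ + 8m x² + m(16m+1) x` ((11)) and `B = B_m : Y² + XY = X³ − 16m X² − 8m X − m`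
(model (1); both in `KramerCurves`); `f : A → B` is the `2`-isogeny with kernel `⟨(0,0)⟩` and
`g : B → A` its dual, `B_g = ker g = {O, T}` with `T = (−1/4, 1/8)` (Lemma 3). (Naming: Kramer's §3
writes `T` for the kernel point of `f` on `A`, which is `(0,0) = T₁` in §5; throughout this file `T`
denotes the generator `(−1/4, 1/8)` of `B_g`, the point written `T′` in the docstring of the named
fact `Kramer1983_shaG_of_selmerG`.) Since `Γ_ℚ` acts trivially on `B_g ≅ ℤ/2`,
`H¹(ℚ, B_g) = Hom(Γ_ℚ, ℤ/2) = ℚ*/ℚ*²` (§3), `[d] ↦ χ_d` (the quadratic character cut out by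
`√d`), and the map `H¹(ℚ, B_g) → H¹(ℚ, B)` of diagram (4) sends `[d]` to the class `ξ_d` of the
cocycle `σ ↦ χ_d(σ) T`. We construct exactly this:

* `KramerShaG.kramerPhi` — the continuous cocycle `σ ↦ χ_d(σ) T : Γ_ℚ → B(ℚ̄)` (`0` if `σ √d = √d`,
  `T` otherwise; continuity = the stabiliser of `√d` is clopen), `KramerShaG.kramerXi` its class
  `ξ_d ∈ H¹(ℚ, B)`, `KramerShaG.kramerXiHom = Ξ` the induced homomorphism on `ℚ*/ℚ*²`
  (`ξ_{dd'} = ξ_d + ξ_{d'}` because `χ` is a character and `T + T = O`; squares give `ξ = 0`);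
  `2 ξ_d = 0`.
* **Kernel** (`KramerShaG.sqClass_mem_range_of_kramerXi_eq_zero`; exactness of
  `A(ℚ) →γ H¹(ℚ, B_g) → H¹(ℚ, B)` in (4)/(9) at the place where it is used). If `ξ_d` is a
  coboundary, `χ_d(σ) T = σv − v` for some `v ∈ B(ℚ̄)`. The dual isogeny on coordinates is
  `x(g(X, Y)) = μ²`, `μ = (2Y + X)/(4X + 1)` (`KramerShaG.kramerMu/kramerGX/kramerGY`,
  `KramerShaG.equation_kramerCurveA_g`; Silverman X.4, Example 4.8–Prop. 4.9 for
  `φ̂ : E′ → E` transported along `B ≅ E′ : X′ = X + 1/4, Y′ = Y + X/2`, cf. the models of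
  `KramerShaIsogeny`), and translation by `T` changes the sign of `μ` (`KramerShaG.kramerMu_tr`,
  with the explicit translation `KramerShaG.kramerTrX/kramerTrY`, `KramerShaG.some_add_kramerT`).
  Hence `g(v) ∈ A(ℚ)` (Galois descent of its coordinates, `exists_algebraMap_eq_of_forall_galEquiv`)
  and `σ(μ(v)) = ±μ(v)` exactly as `σ(√d) = ±√d`, so `μ(v)/√d ∈ ℚ` and
  `γ(g(v)) = [x(g(v))] = [μ²] = [d]` — the Remark of §4 (`γ` = first coordinate of `λ`). The
  degenerate `v` (`v ∈ {O, T}`: `d ∈ ℚ²`, `γ(O) = 1`; `v ∈ B[2] ∖ B_g`: `g(v) = (0,0) = T₁`,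
  `[d] = [m(16m+1)] = γ(T₁)`) are treated separately (`KramerShaG.sq_eq_of_twoTorsion`, …).
* **Local conditions** (`KramerShaG.kramerXi_mem_localRestrictionKer`; the compatibility of (4)
  with localisation that makes `S(A/gB) → Ш(B, ℚ)_g` in (9) well defined). For a field `E` with
  `ℚ → E` (a completion) and `Γ_E → Γ_ℚ`, `B(ℚ̄) → B(Ē)` the tree's restriction data
  (`resGal`, `pointsMap`, `closureEmb`, file `Sha`), suppose `[d]_E = γ_E(P)` with `P ∈ A(E)`.
  Then `res ξ_d` is the coboundary of an explicit `a ∈ B(Ē)`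
  (`oneCocycleClass_mem_resKer_iff`): `a = O` if `P = O` (`d ∈ E²`, every `τ` fixes `√d`);
  `a = (8m + 2ρ, −(8m + 2ρ)/2) ∈ B[2]`, `ρ = w/√d`, if `P = T₁ = (0, 0)` (`m(16m+1) d = w²`);
  and `a = Q(μ)`, the `g`-preimage of `P = (x₀, y₀)` with `μ(Q(μ)) = μ = w/√d` (`x₀ d = w²`;
  `KramerShaG.kramerQX/kramerQY`, `KramerShaG.equation_kramerQ`, `KramerShaG.kramerTrX_kramerQX`),
  otherwise; in each case `τ a = a` if `τ √d = √d` and `τ a = a + T` if `τ √d = −√d`.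

All identities between rational functions are certified by `linear_combination` with explicit
polynomial certificates (no `field_simp` normal forms are relied upon).

## References

* K. Kramer, Proc. Amer. Math. Soc. 89 (1983) 379–386, doi:10.1090/s0002-9939-1983-0715850-1:
  §3 (diagram (4), `H¹(K, B_g) = K*/K*²`), §4 Remark (`γ_K`), §5 (9)–(10) and Lemma 3
  (`B_g = ⟨(−1/4, 1/8)⟩`). [Kramer1983] (held, read in full).
* J. H. Silverman, *The Arithmetic of Elliptic Curves*, 2nd ed. (2009): III.4 Example 4.5 (the
  `2`-isogeny and its dual), X.4 Example 4.8 and Proposition 4.9 (descent via two-isogeny: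
  `δ(X, Y) = X`, `δ(0,0) = a² − 4b`, `δ(O) = 1`). [SilvermanAEC2009] (held).

## Design

Everything auxiliary lives in the sub-namespace `Literature.NumberTheory.EllipticCurves.KramerShaG`;
only the discharge `Kramer1983_shaG_of_selmerG_holds` and the assembly
`Kramer1983_twoRank_sha_family_of_generators_local` are declared in the shared namespace. The
coordinate algebra (`section IsogenyAlgebra`) is over an arbitrary field of characteristic `0`
because it is used over `ℚ̄` (kernel) and over `Ē` for the completions `E` (local conditions); the
tree's `equation_kramerCurveB_neg_quarter`, `negY_kramerCurveB_neg_quarter`,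
`isElliptic_kramerCurveA`, `isElliptic_kramerCurveB` (`KramerCurves`, over `ℚ` with `m ∈ ℤ`) are the
rational cases of `KramerShaG.equation_kramerCurveB_T`, `KramerShaG.negY_kramerCurveB_T`,
`KramerShaG.isElliptic_kramerCurveA_of_ne`, `KramerShaG.isElliptic_kramerCurveB_of_ne`. Points over
`ℚ̄`/`Ē` are handled through their coordinates (`KramerShaG.smul_geomPoints_some`,
`KramerShaG.pointsMap_some`, `KramerShaG.Point_some_ext`), never through `simp` across the
`geomPoints`/`localPoints` abbreviations. `KramerShaG.galEquiv σ : ℚ̄ ≃ₐ[ℚ] ℚ̄` is the identity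
coercion of `Field.absoluteGaloisGroup ℚ`, introduced only to give `simp`/`rw` a stable head symbol.
-/

noncomputable section

open scoped Classical

open WeierstrassCurve WeierstrassCurve.Affine WeierstrassCurve.Affine.Point

namespace Literature.NumberTheory.EllipticCurves

namespace KramerShaG

/-! ### The rational `2`-torsion point `T = (−1/4, 1/8)` of `B_m` and translation by it -/

section IsogenyAlgebra

variable {F : Type*} [Field F] [CharZero F] (m : F)

/-- `T = (−1/4, 1/8)` lies on `B_m` over any field of characteristic `0` (Lemma 3: "`(−1/4, 1/8)` is
easily seen to be the only point of order 2 in `B(ℚ)`"; over `ℚ` this is the tree's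
`equation_kramerCurveB_neg_quarter`, restated here for arbitrary `F ⊇ ℚ` because it is used over
`ℚ̄` and over the algebraic closures of the completions). [cite: Kramer1983, Lemma 3] -/
theorem equation_kramerCurveB_T : (kramerCurveB m).toAffine.Equation (-1 / 4) (1 / 8) := by
  rw [WeierstrassCurve.Affine.equation_iff]
  simp only [kramerCurveB]
  ring

/-- `−T = T`: `negY (−1/4) (1/8) = 1/8` (over `ℚ`: the tree's `negY_kramerCurveB_neg_quarter`).
[cite: Kramer1983, Lemma 3] -/
theorem negY_kramerCurveB_T : (kramerCurveB m).toAffine.negY (-1 / 4) (1 / 8) = 1 / 8 := by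
  simp only [WeierstrassCurve.Affine.negY, kramerCurveB]
  norm_num

omit [CharZero F] in
/-- `B_m` is an elliptic curve over any field in which `m (16m + 1) ≠ 0` (`Δ_B = m(16m+1)`; over `ℚ`
with `m ∈ ℤ ∖ {0}` this is the tree's `isElliptic_kramerCurveB`). [cite: Kramer1983, §2 (p. 380)] -/
theorem isElliptic_kramerCurveB_of_ne (hm : m * (16 * m + 1) ≠ 0) : (kramerCurveB m).IsElliptic := by
  rw [WeierstrassCurve.isElliptic_iff, kramerCurveB_Δ, isUnit_iff_ne_zero]
  exact hm

/-- `T` is a nonsingular point of `B_m` (`B_m` elliptic). [cite: Kramer1983, Lemma 3] -/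
theorem nonsingular_kramerCurveB_T (hm : m * (16 * m + 1) ≠ 0) :
    (kramerCurveB m).toAffine.Nonsingular (-1 / 4) (1 / 8) := by
  haveI := isElliptic_kramerCurveB_of_ne m hm
  exact (WeierstrassCurve.Affine.equation_iff_nonsingular).mp (equation_kramerCurveB_T m)

/-- The point `T = (−1/4, 1/8) ∈ B_m(F)`, generator of the kernel `B_g` of the dual isogeny
`g : B → A` (Lemma 3: the only rational point of order `2` on `B`; it is the `T′` of the named fact
`Kramer1983_shaG_of_selmerG` — not the `T` of Kramer's §3 sentence "`f : A → B` with kernel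
`{0, T}`", which is the point `(0,0)` of `A`). [cite: Kramer1983, Lemma 3] -/
def kramerT (hm : m * (16 * m + 1) ≠ 0) : (kramerCurveB m).toAffine.Point :=
  .some (-1 / 4) (1 / 8) (nonsingular_kramerCurveB_T m hm)

/-- `T` has order `2`: `−T = T`. [cite: Kramer1983, Lemma 3] -/
theorem neg_kramerT (hm : m * (16 * m + 1) ≠ 0) : -kramerT m hm = kramerT m hm := by
  rw [kramerT, neg_some]
  congr 1
  exact negY_kramerCurveB_T m

/-- `T + T = O`. [cite: Kramer1983, Lemma 3] -/
theorem kramerT_add_kramerT (hm : m * (16 * m + 1) ≠ 0) : kramerT m hm + kramerT m hm = 0 := by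
  nth_rewrite 1 [← neg_kramerT m hm]
  exact neg_add_cancel _

/-- The abscissa of `P + T` for `P = (X, Y) ∈ B_m`, `X ≠ −1/4`: `4 x(P + T) + 1 = 1/(4X + 1)`
(translation by the kernel point of a `2`-isogeny: `(x(P+T) − x(T))(x(P) − x(T)) = 1/16`, the
product of the differences of the `2`-division roots). [folklore] -/
def kramerTrX (X : F) : F := ((4 * X + 1)⁻¹ - 1) / 4

/-- The ordinate of `P + T`: `2 y(P + T) + x(P + T) = −(2Y + X)/(4X + 1)²`. [folklore] -/
def kramerTrY (X Y : F) : F := (-(2 * Y + X) * (4 * X + 1)⁻¹ ^ 2 - kramerTrX X) / 2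

/-- `4 · kramerTrX X + 1 = (4X + 1)⁻¹`. [folklore] -/
theorem four_mul_kramerTrX_add_one (X : F) : 4 * kramerTrX X + 1 = (4 * X + 1)⁻¹ := by
  rw [kramerTrX]; ring

/-- `2 · kramerTrY X Y + kramerTrX X = −(2Y + X)/(4X+1)²`. [folklore] -/
theorem two_mul_kramerTrY_add (X Y : F) :
    2 * kramerTrY X Y + kramerTrX X = -(2 * Y + X) * (4 * X + 1)⁻¹ ^ 2 := by
  rw [kramerTrY]; ring

variable {m}

/-- The abscissa of the chord sum `P + T` is `kramerTrX X` (uses the equation of `B_m`).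
[folklore] -/
theorem addX_kramerT {X Y : F} (hE : (kramerCurveB m).toAffine.Equation X Y) (hX : X ≠ -1 / 4) :
    (kramerCurveB m).toAffine.addX X (-1 / 4) ((kramerCurveB m).toAffine.slope X (-1 / 4) Y (1 / 8)) =
      kramerTrX X := by
  have hD : 4 * X + 1 ≠ 0 := fun h0 => hX (by linear_combination h0 / 4)
  have hXT : X - -1 / 4 ≠ 0 := fun h0 => hX (by linear_combination h0)
  set w := (4 * X + 1)⁻¹ with hw'
  have hw : (4 * X + 1) * w = 1 := mul_inv_cancel₀ hD
  have hs : (Y - 1 / 8) / (X - -1 / 4) = (4 * Y - 1 / 2) * w := by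
    rw [div_eq_iff hXT]; linear_combination (-(Y - 1 / 8)) * hw
  rw [WeierstrassCurve.Affine.equation_iff] at hE
  simp only [kramerCurveB] at hE
  rw [slope_of_X_ne hX, hs]
  simp only [addX, kramerCurveB, kramerTrX]
  rw [← hw']
  linear_combination (16 * w ^ 2) * hE +
    (-64 * m * X * w + -16 * m * w + -16 * m + 4 * X ^ 2 * w + (-1) * X * w + X + -4 * Y * w +
      (1 / 4 : F) * w + (-1 / 2 : F)) * hw

/-- The ordinate of the chord sum `P + T` is `kramerTrY X Y`. [folklore] -/
theorem addY_kramerT {X Y : F} (hE : (kramerCurveB m).toAffine.Equation X Y) (hX : X ≠ -1 / 4) :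
    (kramerCurveB m).toAffine.addY X (-1 / 4) Y ((kramerCurveB m).toAffine.slope X (-1 / 4) Y (1 / 8)) =
      kramerTrY X Y := by
  have hD : 4 * X + 1 ≠ 0 := fun h0 => hX (by linear_combination h0 / 4)
  have hXT : X - -1 / 4 ≠ 0 := fun h0 => hX (by linear_combination h0)
  set w := (4 * X + 1)⁻¹ with hw'
  have hw : (4 * X + 1) * w = 1 := mul_inv_cancel₀ hD
  have hs : (Y - 1 / 8) / (X - -1 / 4) = (4 * Y - 1 / 2) * w := by
    rw [div_eq_iff hXT]; linear_combination (-(Y - 1 / 8)) * hw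
  simp only [addY, negAddY, negY]
  rw [addX_kramerT hE hX, slope_of_X_ne hX, hs]
  simp only [kramerCurveB, kramerTrY, kramerTrX]
  rw [← hw']
  linear_combination (Y + (1 / 8 : F) * w + (-1 / 8 : F)) * hw

/-- `P + T` is a nonsingular point with coordinates `(kramerTrX X, kramerTrY X Y)`. [folklore] -/
theorem nonsingular_kramerTr (hm : m * (16 * m + 1) ≠ 0) {X Y : F}
    (h : (kramerCurveB m).toAffine.Nonsingular X Y) (hX : X ≠ -1 / 4) :
    (kramerCurveB m).toAffine.Nonsingular (kramerTrX X) (kramerTrY X Y) := by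
  have := nonsingular_add h (nonsingular_kramerCurveB_T m hm) (fun hh => hX hh.1)
  rwa [addX_kramerT h.left hX, addY_kramerT h.left hX] at this

/-- **Translation by `T` on `B_m`**: for `P = (X, Y) ∈ B_m(F)` with `X ≠ −1/4`,
`P + T = (X₃, Y₃)` with `4X₃ + 1 = 1/(4X+1)` and `2Y₃ + X₃ = −(2Y+X)/(4X+1)²` (chord through
`P` and `T`; the first identity uses the equation of `B_m`, the second is formal). [folklore] -/
theorem some_add_kramerT (hm : m * (16 * m + 1) ≠ 0) {X Y : F}
    (h : (kramerCurveB m).toAffine.Nonsingular X Y) (hX : X ≠ -1 / 4)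
    (h₃ : (kramerCurveB m).toAffine.Nonsingular (kramerTrX X) (kramerTrY X Y)) :
    Point.some X Y h + kramerT m hm = Point.some (kramerTrX X) (kramerTrY X Y) h₃ := by
  rw [kramerT, add_of_X_ne hX]
  simp only [some.injEq]
  exact ⟨addX_kramerT h.left hX, addY_kramerT h.left hX⟩


/-! ### The `2`-isogeny `g : B → A` on coordinates -/

/-- `μ(P) = (2Y + X)/(4X + 1)` for `P = (X, Y) ∈ B_m`: the function with `x(g(P)) = μ(P)²`
(`g = φ̂ ∘ (B ≅ E′)` for Silverman's `φ̂ : E′ → E`, `(X′, Y′) ↦ (Y′²/(4X′²), …)`, `μ = Y′/(2X′)`,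
`X′ = X + 1/4`, `Y′ = Y + X/2`). [cite: SilvermanAEC2009, X.4.9 (and III.4.5)] -/
def kramerMu (X Y : F) : F := (2 * Y + X) * (4 * X + 1)⁻¹

/-- `x(g(P)) = μ(P)²`. [cite: SilvermanAEC2009, X.4.9] -/
def kramerGX (X Y : F) : F := kramerMu X Y ^ 2

/-- `y(g(P))` in the coordinates of `A_m` (`y = y′ − x/2`, `y′ = μ (1/16 − X′²)/(4X′)`).
[cite: SilvermanAEC2009, X.4.9 (and III.4.5)] -/
def kramerGY (X Y : F) : F :=
  kramerMu X Y * (1 - (4 * X + 1) ^ 2) * (4 * X + 1)⁻¹ / 16 - kramerMu X Y ^ 2 / 2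

/-- **`g(P) ∈ A_m`** for `P = (X, Y) ∈ B_m` with `X ≠ −1/4`: the image point
`(kramerGX X Y, kramerGY X Y)` satisfies the equation of `A_m`. [cite: SilvermanAEC2009, X.4.9 (and III.4.5)] -/
theorem equation_kramerCurveA_g {X Y : F} (hE : (kramerCurveB m).toAffine.Equation X Y) (hX : X ≠ -1 / 4) :
    (kramerCurveA m).toAffine.Equation (kramerGX X Y) (kramerGY X Y) := by
  have hD : 4 * X + 1 ≠ 0 := fun h0 => hX (by linear_combination h0 / 4)
  set w := (4 * X + 1)⁻¹ with hw'
  have hw : (4 * X + 1) * w = 1 := mul_inv_cancel₀ hD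
  rw [WeierstrassCurve.Affine.equation_iff] at hE ⊢
  simp only [kramerCurveB] at hE
  simp only [kramerCurveA, kramerGX, kramerGY, kramerMu]
  rw [← hw']
  linear_combination (
      -256 * m * X ^ 4 * w ^ 6 + -1024 * m * X ^ 3 * Y * w ^ 6 + -128 * m * X ^ 3 * w ^ 6 +
      -1024 * m * X ^ 2 * Y ^ 2 * w ^ 6 + -512 * m * X ^ 2 * Y * w ^ 6 + -16 * m * X ^ 2 * w ^ 6 +
      -512 * m * X * Y ^ 2 * w ^ 6 + -64 * m * X * Y * w ^ 6 + -64 * m * Y ^ 2 * w ^ 6 +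
      -16 * X ^ 5 * w ^ 6 + -64 * X ^ 4 * Y * w ^ 6 + -24 * X ^ 4 * w ^ 6 +
      -64 * X ^ 3 * Y ^ 2 * w ^ 6 + -112 * X ^ 3 * Y * w ^ 6 + -8 * X ^ 3 * w ^ 6 +
      -176 * X ^ 2 * Y ^ 2 * w ^ 6 + -32 * X ^ 2 * Y * w ^ 6 + (-1) * X ^ 2 * w ^ 6 +
      -128 * X * Y ^ 3 * w ^ 6 + -32 * X * Y ^ 2 * w ^ 6 + -4 * X * Y * w ^ 6 +
      -64 * Y ^ 4 * w ^ 6 + -4 * Y ^ 2 * w ^ 6) * hE + (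
      1024 * m ^ 2 * X ^ 5 * w ^ 5 + 4096 * m ^ 2 * X ^ 4 * Y * w ^ 5 +
      768 * m ^ 2 * X ^ 4 * w ^ 5 + 256 * m ^ 2 * X ^ 4 * w ^ 4 +
      4096 * m ^ 2 * X ^ 3 * Y ^ 2 * w ^ 5 + 3072 * m ^ 2 * X ^ 3 * Y * w ^ 5 +
      1024 * m ^ 2 * X ^ 3 * Y * w ^ 4 + 192 * m ^ 2 * X ^ 3 * w ^ 5 +
      128 * m ^ 2 * X ^ 3 * w ^ 4 + 64 * m ^ 2 * X ^ 3 * w ^ 3 +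
      3072 * m ^ 2 * X ^ 2 * Y ^ 2 * w ^ 5 + 1024 * m ^ 2 * X ^ 2 * Y ^ 2 * w ^ 4 +
      768 * m ^ 2 * X ^ 2 * Y * w ^ 5 + 512 * m ^ 2 * X ^ 2 * Y * w ^ 4 +
      256 * m ^ 2 * X ^ 2 * Y * w ^ 3 + 16 * m ^ 2 * X ^ 2 * w ^ 5 + 16 * m ^ 2 * X ^ 2 * w ^ 4 +
      16 * m ^ 2 * X ^ 2 * w ^ 3 + 16 * m ^ 2 * X ^ 2 * w ^ 2 + 768 * m ^ 2 * X * Y ^ 2 * w ^ 5 +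
      512 * m ^ 2 * X * Y ^ 2 * w ^ 4 + 256 * m ^ 2 * X * Y ^ 2 * w ^ 3 +
      64 * m ^ 2 * X * Y * w ^ 5 + 64 * m ^ 2 * X * Y * w ^ 4 + 64 * m ^ 2 * X * Y * w ^ 3 +
      64 * m ^ 2 * X * Y * w ^ 2 + 64 * m ^ 2 * Y ^ 2 * w ^ 5 + 64 * m ^ 2 * Y ^ 2 * w ^ 4 +
      64 * m ^ 2 * Y ^ 2 * w ^ 3 + 64 * m ^ 2 * Y ^ 2 * w ^ 2 + 96 * m * X ^ 5 * w ^ 5 +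
      512 * m * X ^ 4 * Y * w ^ 5 + 56 * m * X ^ 4 * w ^ 5 + 24 * m * X ^ 4 * w ^ 4 +
      1024 * m * X ^ 3 * Y ^ 2 * w ^ 5 + 256 * m * X ^ 3 * Y * w ^ 5 +
      128 * m * X ^ 3 * Y * w ^ 4 + 12 * m * X ^ 3 * w ^ 5 + 8 * m * X ^ 3 * w ^ 4 +
      4 * m * X ^ 3 * w ^ 3 + 1024 * m * X ^ 2 * Y ^ 3 * w ^ 5 + 384 * m * X ^ 2 * Y ^ 2 * w ^ 5 +
      256 * m * X ^ 2 * Y ^ 2 * w ^ 4 + 48 * m * X ^ 2 * Y * w ^ 5 + 32 * m * X ^ 2 * Y * w ^ 4 +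
      16 * m * X ^ 2 * Y * w ^ 3 + m * X ^ 2 * w ^ 5 + m * X ^ 2 * w ^ 4 + m * X ^ 2 * w ^ 3 +
      m * X ^ 2 * w ^ 2 + 512 * m * X * Y ^ 4 * w ^ 5 + 256 * m * X * Y ^ 3 * w ^ 5 +
      256 * m * X * Y ^ 3 * w ^ 4 + 48 * m * X * Y ^ 2 * w ^ 5 + 32 * m * X * Y ^ 2 * w ^ 4 +
      16 * m * X * Y ^ 2 * w ^ 3 + 4 * m * X * Y * w ^ 5 + 4 * m * X * Y * w ^ 4 +
      4 * m * X * Y * w ^ 3 + 4 * m * X * Y * w ^ 2 + 128 * m * Y ^ 4 * w ^ 5 +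
      128 * m * Y ^ 4 * w ^ 4 + 4 * m * Y ^ 2 * w ^ 5 + 4 * m * Y ^ 2 * w ^ 4 +
      4 * m * Y ^ 2 * w ^ 3 + 4 * m * Y ^ 2 * w ^ 2 + -4 * X ^ 7 * w ^ 5 +
      -16 * X ^ 6 * Y * w ^ 5 + -5 * X ^ 6 * w ^ 5 + (-1) * X ^ 6 * w ^ 4 +
      -16 * X ^ 5 * Y ^ 2 * w ^ 5 + -20 * X ^ 5 * Y * w ^ 5 + -4 * X ^ 5 * Y * w ^ 4 +
      (-1) * X ^ 5 * w ^ 5 + (-1) * X ^ 5 * w ^ 4 + -20 * X ^ 4 * Y ^ 2 * w ^ 5 +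
      -4 * X ^ 4 * Y ^ 2 * w ^ 4 + -4 * X ^ 4 * Y * w ^ 4 + 16 * X ^ 3 * Y ^ 2 * w ^ 5 +
      -4 * X ^ 3 * Y ^ 2 * w ^ 4 + X ^ 3 * Y * w ^ 5 + X ^ 3 * Y * w ^ 4 +
      32 * X ^ 2 * Y ^ 3 * w ^ 5 + 5 * X ^ 2 * Y ^ 2 * w ^ 5 + 5 * X ^ 2 * Y ^ 2 * w ^ 4 +
      16 * X * Y ^ 4 * w ^ 5 + 8 * X * Y ^ 3 * w ^ 5 + 8 * X * Y ^ 3 * w ^ 4 + 4 * Y ^ 4 * w ^ 5 +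
      4 * Y ^ 4 * w ^ 4) * hw

/-- `μ(P + T) = −μ(P)`. [folklore] -/
theorem kramerMu_tr {X Y : F} (hX : X ≠ -1 / 4) :
    kramerMu (kramerTrX X) (kramerTrY X Y) = -kramerMu X Y := by
  have hD : 4 * X + 1 ≠ 0 := fun h0 => hX (by linear_combination h0 / 4)
  unfold kramerMu
  rw [two_mul_kramerTrY_add, four_mul_kramerTrX_add_one, inv_inv]
  have hw : (4 * X + 1) * (4 * X + 1)⁻¹ = 1 := mul_inv_cancel₀ hD
  linear_combination (-(2 * Y + X) * (4 * X + 1)⁻¹) * hw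

/-- `x(g(P + T)) = x(g(P))`. [folklore] -/
theorem kramerGX_tr {X Y : F} (hX : X ≠ -1 / 4) :
    kramerGX (kramerTrX X) (kramerTrY X Y) = kramerGX X Y := by
  unfold kramerGX; rw [kramerMu_tr hX, neg_sq]

/-- `y(g(P + T)) = y(g(P))` (so `g(P + T) = g(P)`: `T` generates `ker g`). [folklore] -/
theorem kramerGY_tr {X Y : F} (hX : X ≠ -1 / 4) :
    kramerGY (kramerTrX X) (kramerTrY X Y) = kramerGY X Y := by
  have hD : 4 * X + 1 ≠ 0 := fun h0 => hX (by linear_combination h0 / 4)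
  unfold kramerGY
  rw [kramerMu_tr hX, four_mul_kramerTrX_add_one, inv_inv]
  have hw : (4 * X + 1) * (4 * X + 1)⁻¹ = 1 := mul_inv_cancel₀ hD
  linear_combination (kramerMu X Y / 16 * ((4 * X + 1)⁻¹ + (4 * X + 1))) * hw

/-! ### The `2`-torsion of `B_m` -/

/-- A `2`-torsion point `(X, −X/2) ≠ T` of `B_m` has `((X − 8m)/2)² = m(16m+1)` (the other roots
`X = 8m ± 2√(m(16m+1))` of the `2`-division cubic `(X + 1/4)(X² − 16mX − 4m)`). [cite: Kramer1983, Lemma 3] -/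
theorem sq_eq_of_twoTorsion {X Y : F} (hE : (kramerCurveB m).toAffine.Equation X Y)
    (h2 : 2 * Y + X = 0) (hX : X ≠ -1 / 4) : ((X - 8 * m) / 2) ^ 2 = m * (16 * m + 1) := by
  rw [WeierstrassCurve.Affine.equation_iff] at hE
  simp only [kramerCurveB] at hE
  have hX' : X + 1 / 4 ≠ 0 := fun h0 => hX (by linear_combination h0)
  have key : (X + 1 / 4) * ((X - 8 * m) ^ 2 - 4 * (m * (16 * m + 1))) = 0 := by
    linear_combination (-1) * hE + ((2 * Y + X) / 4) * h2
  have := (mul_eq_zero.mp key).resolve_left hX'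
  linear_combination this / 4

/-- For `ρ² = m(16m+1)`: translation of the `2`-torsion point `X = 8m + 2ρ` by `T` gives
`X = 8m − 2ρ`. [folklore] -/
theorem kramerTrX_of_twoTorsion {ρ : F} (hρ : ρ ^ 2 = m * (16 * m + 1)) :
    kramerTrX (8 * m + 2 * ρ) = 8 * m - 2 * ρ := by
  unfold kramerTrX
  have h : (4 * (8 * m + 2 * ρ) + 1) * (32 * m + 1 - 8 * ρ) = 1 := by linear_combination (-64) * hρ
  rw [inv_eq_of_mul_eq_one_right h]
  ring

/-- The ordinate of the translated `2`-torsion point. [folklore] -/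
theorem kramerTrY_of_twoTorsion {ρ : F} (hρ : ρ ^ 2 = m * (16 * m + 1)) :
    kramerTrY (8 * m + 2 * ρ) (-(8 * m + 2 * ρ) / 2) = -(8 * m - 2 * ρ) / 2 := by
  have h := two_mul_kramerTrY_add (8 * m + 2 * ρ) (-(8 * m + 2 * ρ) / 2)
  rw [kramerTrX_of_twoTorsion hρ] at h
  linear_combination h / 2

/-- The `2`-torsion point `(8m + 2ρ, −(8m+2ρ)/2)` lies on `B_m` when `ρ² = m(16m+1)`.
[cite: Kramer1983, Lemma 3] -/
theorem equation_twoTorsion {ρ : F} (hρ : ρ ^ 2 = m * (16 * m + 1)) :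
    (kramerCurveB m).toAffine.Equation (8 * m + 2 * ρ) (-(8 * m + 2 * ρ) / 2) := by
  rw [WeierstrassCurve.Affine.equation_iff]
  simp only [kramerCurveB]
  linear_combination (-32 * m - 8 * ρ - 1) * hρ

/-- `8m + 2ρ ≠ −1/4` (else `(32m+1)² = 64 m(16m+1)`, i.e. `1 = 0`). [folklore] -/
theorem twoTorsion_X_ne {ρ : F} (hρ : ρ ^ 2 = m * (16 * m + 1)) : 8 * m + 2 * ρ ≠ -1 / 4 := by
  intro h
  have h1 : ρ = -(32 * m + 1) / 8 := by linear_combination h / 2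
  rw [h1] at hρ
  have : (1 : F) = 0 := by linear_combination 64 * hρ
  exact one_ne_zero this

/-! ### The local points `Q(μ) ∈ B` over a `g`-preimage -/

/-- The denominator `D(μ) = (2y₀ + x₀) + μ (2x₀ + (32m+1)/4)` of the `g`-preimage formula.
[folklore] -/
def kramerQden (m x₀ y₀ μ : F) : F := (2 * y₀ + x₀) + μ * (2 * x₀ + (32 * m + 1) / 4)

/-- The abscissa `X(Q) = μ/(16 D(μ)) − 1/4` of the point `Q(μ) ∈ B_m` with `g(Q(μ)) = (x₀, y₀)`,
`μ(Q(μ)) = μ`, for `μ² = x₀`. [cite: SilvermanAEC2009, X.4.9 (inverting φ̂)] -/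
def kramerQX (m x₀ y₀ μ : F) : F := μ * (16 * kramerQden m x₀ y₀ μ)⁻¹ - 1 / 4

/-- The ordinate `Y(Q) = 2 X′ μ − X(Q)/2` (`X′ = X(Q) + 1/4`) of `Q(μ)`. [cite: SilvermanAEC2009, X.4.9 (inverting φ̂)] -/
def kramerQY (m x₀ y₀ μ : F) : F :=
  2 * (μ * (16 * kramerQden m x₀ y₀ μ)⁻¹) * μ - kramerQX m x₀ y₀ μ / 2

/-- `D(μ) ≠ 0` for `x₀ ≠ 0` (else `(2y₀ + x₀)² = x₀ (2x₀ + a)²`, forcing `a² = 4b`, but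
`a² − 4b = 1/16`). [folklore] -/
theorem kramerQden_ne_zero {x₀ y₀ μ : F} (hA : (kramerCurveA m).toAffine.Equation x₀ y₀)
    (hμ : μ ^ 2 = x₀) (hx : x₀ ≠ 0) : kramerQden m x₀ y₀ μ ≠ 0 := by
  intro h0
  rw [WeierstrassCurve.Affine.equation_iff] at hA
  simp only [kramerCurveA] at hA
  subst hμ
  have h1 : 2 * y₀ + μ ^ 2 = -(μ * (2 * μ ^ 2 + (32 * m + 1) / 4)) := by
    unfold kramerQden at h0; linear_combination h0
  have h2 : (2 * y₀ + μ ^ 2) ^ 2 = μ ^ 2 * (2 * μ ^ 2 + (32 * m + 1) / 4) ^ 2 := by rw [h1]; ring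
  have h3 : (2 * y₀ + μ ^ 2) ^ 2 = 4 * μ ^ 6 + (32 * m + 1) * μ ^ 4 + 4 * m * (16 * m + 1) * μ ^ 2 := by
    linear_combination 4 * hA
  have h4 : μ ^ 2 = 0 := by linear_combination (-16) * h2 + 16 * h3
  exact hx h4

/-- `4 X(Q) + 1 = 4μ/(16 D(μ))`. [folklore] -/
theorem four_mul_kramerQX_add_one (x₀ y₀ μ : F) :
    4 * kramerQX m x₀ y₀ μ + 1 = 4 * μ * (16 * kramerQden m x₀ y₀ μ)⁻¹ := by
  unfold kramerQX; ring

/-- `2 Y(Q) + X(Q) = 4μ²/(16 D(μ))`. [folklore] -/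
theorem two_mul_kramerQY_add (x₀ y₀ μ : F) :
    2 * kramerQY m x₀ y₀ μ + kramerQX m x₀ y₀ μ = 4 * μ ^ 2 * (16 * kramerQden m x₀ y₀ μ)⁻¹ := by
  unfold kramerQY; ring

/-- `X(Q) ≠ −1/4` (`μ ≠ 0`). [folklore] -/
theorem kramerQX_ne {x₀ y₀ μ : F} (hμ0 : μ ≠ 0) (hden : kramerQden m x₀ y₀ μ ≠ 0) :
    kramerQX m x₀ y₀ μ ≠ -1 / 4 := by
  intro h
  have h1 : 4 * kramerQX m x₀ y₀ μ + 1 = 0 := by rw [h]; ring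
  rw [four_mul_kramerQX_add_one] at h1
  have h16 : (16 : F) ≠ 0 := by norm_num
  exact (mul_ne_zero (mul_ne_zero (by norm_num) hμ0) (inv_ne_zero (mul_ne_zero h16 hden))) h1

/-- **`Q(μ) ∈ B_m`**. [cite: SilvermanAEC2009, X.4.9 (inverting φ̂)] -/
theorem equation_kramerQ {x₀ y₀ μ : F} (hA : (kramerCurveA m).toAffine.Equation x₀ y₀)
    (hμ : μ ^ 2 = x₀) (hx : x₀ ≠ 0) :
    (kramerCurveB m).toAffine.Equation (kramerQX m x₀ y₀ μ) (kramerQY m x₀ y₀ μ) := by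
  have hden := kramerQden_ne_zero hA hμ hx
  have h16 : (16 : F) * kramerQden m x₀ y₀ μ ≠ 0 := mul_ne_zero (by norm_num) hden
  set v := (16 * kramerQden m x₀ y₀ μ)⁻¹ with hv'
  have hv : 16 * kramerQden m x₀ y₀ μ * v = 1 := mul_inv_cancel₀ h16
  rw [WeierstrassCurve.Affine.equation_iff] at hA ⊢
  simp only [kramerCurveA] at hA
  subst hμ
  simp only [kramerCurveB, kramerQX, kramerQY]
  rw [← hv']
  unfold kramerQden at hv
  linear_combination (
      -64 * μ * v ^ 3) * hA + (
      -8 * m * μ ^ 2 * v ^ 2 + -2 * μ ^ 4 * v ^ 2 + μ ^ 3 * v ^ 2 + (-1 / 4 : F) * μ ^ 2 * v ^ 2 +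
      2 * μ * y₀ * v ^ 2 + (1 / 16 : F) * μ * v) * hv

/-- `16 D(μ) D(−μ) = −μ²` on `A_m` (the two preimages `Q(μ)`, `Q(−μ) = Q(μ) + T`). [folklore] -/
theorem kramerQden_mul_neg {x₀ y₀ μ : F} (hA : (kramerCurveA m).toAffine.Equation x₀ y₀)
    (hμ : μ ^ 2 = x₀) : 16 * kramerQden m x₀ y₀ μ * kramerQden m x₀ y₀ (-μ) = -μ ^ 2 := by
  rw [WeierstrassCurve.Affine.equation_iff] at hA
  simp only [kramerCurveA] at hA
  subst hμ
  unfold kramerQden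
  linear_combination 64 * hA

/-- `(4 X(Q(μ)) + 1)(4 X(Q(−μ)) + 1) = 1`. [folklore] -/
theorem kramerQX_mul_neg {x₀ y₀ μ : F} (hA : (kramerCurveA m).toAffine.Equation x₀ y₀)
    (hμ : μ ^ 2 = x₀) (hx : x₀ ≠ 0) :
    (4 * kramerQX m x₀ y₀ μ + 1) * (4 * kramerQX m x₀ y₀ (-μ) + 1) = 1 := by
  have hden := kramerQden_ne_zero hA hμ hx
  have hden' := kramerQden_ne_zero hA (show (-μ) ^ 2 = x₀ by rw [neg_sq, hμ]) hx
  have hv : 16 * kramerQden m x₀ y₀ μ * (16 * kramerQden m x₀ y₀ μ)⁻¹ = 1 :=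
    mul_inv_cancel₀ (mul_ne_zero (by norm_num) hden)
  have hv' : 16 * kramerQden m x₀ y₀ (-μ) * (16 * kramerQden m x₀ y₀ (-μ))⁻¹ = 1 :=
    mul_inv_cancel₀ (mul_ne_zero (by norm_num) hden')
  have hDD := kramerQden_mul_neg hA hμ
  rw [four_mul_kramerQX_add_one, four_mul_kramerQX_add_one]
  linear_combination (-16 * (16 * kramerQden m x₀ y₀ μ)⁻¹ * (16 * kramerQden m x₀ y₀ (-μ))⁻¹) * hDD +
    (16 * kramerQden m x₀ y₀ (-μ) * (16 * kramerQden m x₀ y₀ (-μ))⁻¹) * hv + hv'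

/-- **`Q(μ) + T = Q(−μ)`**, abscissa. [folklore] -/
theorem kramerTrX_kramerQX {x₀ y₀ μ : F} (hA : (kramerCurveA m).toAffine.Equation x₀ y₀)
    (hμ : μ ^ 2 = x₀) (hx : x₀ ≠ 0) :
    kramerTrX (kramerQX m x₀ y₀ μ) = kramerQX m x₀ y₀ (-μ) := by
  unfold kramerTrX
  rw [inv_eq_of_mul_eq_one_right (kramerQX_mul_neg hA hμ hx)]
  ring

/-- **`Q(μ) + T = Q(−μ)`**, ordinate. [folklore] -/
theorem kramerTrY_kramerQ {x₀ y₀ μ : F} (hA : (kramerCurveA m).toAffine.Equation x₀ y₀)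
    (hμ : μ ^ 2 = x₀) (hx : x₀ ≠ 0) :
    kramerTrY (kramerQX m x₀ y₀ μ) (kramerQY m x₀ y₀ μ) = kramerQY m x₀ y₀ (-μ) := by
  have hden := kramerQden_ne_zero hA hμ hx
  have hden' := kramerQden_ne_zero hA (show (-μ) ^ 2 = x₀ by rw [neg_sq, hμ]) hx
  have hv : 16 * kramerQden m x₀ y₀ μ * (16 * kramerQden m x₀ y₀ μ)⁻¹ = 1 :=
    mul_inv_cancel₀ (mul_ne_zero (by norm_num) hden)
  have hv' : 16 * kramerQden m x₀ y₀ (-μ) * (16 * kramerQden m x₀ y₀ (-μ))⁻¹ = 1 :=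
    mul_inv_cancel₀ (mul_ne_zero (by norm_num) hden')
  have hDD := kramerQden_mul_neg hA hμ
  have e1 := two_mul_kramerTrY_add (kramerQX m x₀ y₀ μ) (kramerQY m x₀ y₀ μ)
  rw [kramerTrX_kramerQX hA hμ hx, inv_eq_of_mul_eq_one_right (kramerQX_mul_neg hA hμ hx),
    two_mul_kramerQY_add, four_mul_kramerQX_add_one] at e1
  -- the key identity `-16 μ² v v' = 1`
  have hk : -16 * μ ^ 2 * (16 * kramerQden m x₀ y₀ μ)⁻¹ * (16 * kramerQden m x₀ y₀ (-μ))⁻¹ = 1 := by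
    linear_combination (-16 * (16 * kramerQden m x₀ y₀ μ)⁻¹ * (16 * kramerQden m x₀ y₀ (-μ))⁻¹) * hDD +
      (16 * kramerQden m x₀ y₀ (-μ) * (16 * kramerQden m x₀ y₀ (-μ))⁻¹) * hv + hv'
  conv_rhs => rw [kramerQY]
  linear_combination e1 / 2 +
    (2 * μ ^ 2 * (16 * kramerQden m x₀ y₀ (-μ))⁻¹) * hk


/-! Variants for a curve propositionally equal to `B_m` (used for `B.baseChange L`). -/

variable {W : WeierstrassCurve F}

/-- `−T = T` on a curve equal to `B_m`. [folklore] -/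
theorem negY_T_of_eq (hW : W = kramerCurveB m) : W.toAffine.negY (-1 / 4) (1 / 8) = 1 / 8 := by
  subst hW; exact negY_kramerCurveB_T m

/-- `T` is nonsingular on a curve equal to `B_m`. [folklore] -/
theorem nonsingular_T_of_eq (hW : W = kramerCurveB m) (hm : m * (16 * m + 1) ≠ 0) :
    W.toAffine.Nonsingular (-1 / 4) (1 / 8) := by
  subst hW; exact nonsingular_kramerCurveB_T m hm

omit [CharZero F] in
/-- A point of `B_m` satisfying the equation is nonsingular (`B_m` elliptic). [folklore] -/
theorem nonsingular_kramerCurveB_of_equation (hm : m * (16 * m + 1) ≠ 0) {X Y : F}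
    (h : (kramerCurveB m).toAffine.Equation X Y) : (kramerCurveB m).toAffine.Nonsingular X Y := by
  haveI := isElliptic_kramerCurveB_of_ne m hm
  exact (WeierstrassCurve.Affine.equation_iff_nonsingular).mp h

omit [CharZero F] in
/-- Nonsingularity from the equation of `B_m`, on a curve equal to `B_m`. [folklore] -/
theorem nonsingular_of_equation_of_eq (hW : W = kramerCurveB m) (hm : m * (16 * m + 1) ≠ 0) {X Y : F}
    (h : (kramerCurveB m).toAffine.Equation X Y) : W.toAffine.Nonsingular X Y := by
  subst hW; exact nonsingular_kramerCurveB_of_equation hm h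

/-- `P + T` is nonsingular, on a curve equal to `B_m`. [folklore] -/
theorem nonsingular_tr_of_eq (hW : W = kramerCurveB m) (hm : m * (16 * m + 1) ≠ 0) {X Y : F}
    (h : W.toAffine.Nonsingular X Y) (hX : X ≠ -1 / 4) :
    W.toAffine.Nonsingular (kramerTrX X) (kramerTrY X Y) := by
  subst hW; exact nonsingular_kramerTr hm h hX

/-- Translation by `T`, on a curve equal to `B_m`. [folklore] -/
theorem some_add_T_of_eq (hW : W = kramerCurveB m) (hm : m * (16 * m + 1) ≠ 0) {X Y : F}
    (h : W.toAffine.Nonsingular X Y) (hX : X ≠ -1 / 4)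
    (hT : W.toAffine.Nonsingular (-1 / 4) (1 / 8))
    (h₃ : W.toAffine.Nonsingular (kramerTrX X) (kramerTrY X Y)) :
    Point.some X Y h + Point.some (-1 / 4) (1 / 8) hT = Point.some (kramerTrX X) (kramerTrY X Y) h₃ := by
  subst hW; exact some_add_kramerT hm h hX h₃

end IsogenyAlgebra

/-! ### The quadratic cocycles `σ ↦ χ_d(σ) · T` in `H¹(ℚ, B)` -/

section Cocycle

open Literature.NumberTheory.GaloisRepresentations

variable (m : ℕ)

/-- An element of `Γ_ℚ` as an automorphism of `ℚ̄` (`Field.absoluteGaloisGroup` is by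
definition `ℚ̄ ≃ₐ[ℚ] ℚ̄`). [folklore] -/
def galEquiv (σ : Field.absoluteGaloisGroup ℚ) : AlgebraicClosure ℚ ≃ₐ[ℚ] AlgebraicClosure ℚ := σ

/-- `m (16m + 1) ≠ 0` in `ℚ` for `m > 0`. [folklore] -/
theorem kramer_hm {m : ℕ} (hm : 0 < m) : (m : ℚ) * (16 * (m : ℚ) + 1) ≠ 0 := by positivity

/-- `B.baseChange L` is `B_m` over `L`. [folklore] -/
theorem kramerCurveB_baseChange (m : ℕ) (L : Type*) [Field L] [Algebra ℚ L] :
    (kramerCurveB (m : ℚ)).baseChange L = kramerCurveB ((m : ℕ) : L) := by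
  rw [WeierstrassCurve.baseChange, map_kramerCurveB, map_natCast]

/-- `m (16 m + 1) ≠ 0` in any field of characteristic zero. [folklore] -/
theorem kramer_hm_cast {m : ℕ} (hm : 0 < m) (L : Type*) [Field L] [CharZero L] :
    ((m : ℕ) : L) * (16 * ((m : ℕ) : L) + 1) ≠ 0 := by
  refine mul_ne_zero (Nat.cast_ne_zero.mpr hm.ne') ?_
  have : ((16 * m + 1 : ℕ) : L) ≠ 0 := Nat.cast_ne_zero.mpr (by omega)
  push_cast at this
  exact this

/-- `T` is nonsingular on `B.baseChange ℚ̄`. [folklore] -/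
theorem nonsingular_Tgeom {m : ℕ} (hm : 0 < m) :
    ((kramerCurveB (m : ℚ)).baseChange (AlgebraicClosure ℚ)).toAffine.Nonsingular (-1 / 4) (1 / 8) :=
  nonsingular_T_of_eq (kramerCurveB_baseChange m _) (kramer_hm_cast hm _)

/-- **`T = (−1/4, 1/8)` as a geometric point of `B_m`** (in `B(ℚ̄)`), the generator of
`B_g = ker g` (Lemma 3). [cite: Kramer1983, Lemma 3] -/
def kramerTgeom {m : ℕ} (hm : 0 < m) : geomPoints (kramerCurveB (m : ℚ)) :=
  Point.some (-1 / 4) (1 / 8) (nonsingular_Tgeom hm)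

/-- The Galois action on an affine geometric point acts on its coordinates. [folklore] -/
theorem smul_geomPoints_some {W : WeierstrassCurve ℚ} (σ : Field.absoluteGaloisGroup ℚ)
    {x y : AlgebraicClosure ℚ} (h : (W.baseChange (AlgebraicClosure ℚ)).toAffine.Nonsingular x y)
    (h' : (W.baseChange (AlgebraicClosure ℚ)).toAffine.Nonsingular (galEquiv σ x) (galEquiv σ y)) :
    σ • (show geomPoints W from Point.some x y h) = Point.some (galEquiv σ x) (galEquiv σ y) h' := by
  change Affine.Point.map ((galEquiv σ : AlgebraicClosure ℚ ≃ₐ[ℚ] AlgebraicClosure ℚ) :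
      AlgebraicClosure ℚ →ₐ[ℚ] AlgebraicClosure ℚ) (Point.some x y h) = _
  rw [Affine.Point.map_some]
  rfl

/-- Affine points with equal coordinates are equal (proof-irrelevance helper). [folklore] -/
theorem Point_some_ext {F' : Type*} [Field F'] {W' : WeierstrassCurve F'} {x y x' y' : F'}
    {h : W'.toAffine.Nonsingular x y} {h' : W'.toAffine.Nonsingular x' y'} (hx : x = x') (hy : y = y') :
    (Point.some x y h : W'.toAffine.Point) = Point.some x' y' h' := by
  subst hx; subst hy; rfl

/-- Nonsingularity is preserved by the Galois action on coordinates. [folklore] -/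
theorem nonsingular_galEquiv {W : WeierstrassCurve ℚ} (σ : Field.absoluteGaloisGroup ℚ)
    {x y : AlgebraicClosure ℚ} (h : (W.baseChange (AlgebraicClosure ℚ)).toAffine.Nonsingular x y) :
    (W.baseChange (AlgebraicClosure ℚ)).toAffine.Nonsingular (galEquiv σ x) (galEquiv σ y) :=
  (W.toAffine.baseChange_nonsingular
    ((galEquiv σ : AlgebraicClosure ℚ ≃ₐ[ℚ] AlgebraicClosure ℚ) :
      AlgebraicClosure ℚ →ₐ[ℚ] AlgebraicClosure ℚ).injective ..).mpr h

/-- `σ(−1/4) = −1/4`. [folklore] -/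
theorem galEquiv_neg_one_div_four (σ : Field.absoluteGaloisGroup ℚ) :
    galEquiv σ (-1 / 4 : AlgebraicClosure ℚ) = -1 / 4 := by
  rw [map_div₀, map_neg, map_one, map_ofNat]

/-- `σ(1/8) = 1/8`. [folklore] -/
theorem galEquiv_one_div_eight (σ : Field.absoluteGaloisGroup ℚ) :
    galEquiv σ (1 / 8 : AlgebraicClosure ℚ) = 1 / 8 := by
  rw [map_div₀, map_one, map_ofNat]

/-- `T` is `Γ_ℚ`-invariant (it is rational). [folklore] -/
@[simp]
theorem smul_kramerTgeom {m : ℕ} (hm : 0 < m) (σ : Field.absoluteGaloisGroup ℚ) :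
    σ • kramerTgeom hm = kramerTgeom hm := by
  unfold kramerTgeom
  rw [smul_geomPoints_some σ _ (nonsingular_galEquiv σ (nonsingular_Tgeom hm))]
  exact Point_some_ext (galEquiv_neg_one_div_four σ) (galEquiv_one_div_eight σ)

/-- `T + T = O` in `B(ℚ̄)`. [cite: Kramer1983, Lemma 3] -/
theorem kramerTgeom_add_self {m : ℕ} (hm : 0 < m) : kramerTgeom hm + kramerTgeom hm = 0 :=
  add_of_Y_eq rfl (negY_T_of_eq (kramerCurveB_baseChange m _)).symm

/-- A square root of `d ∈ ℚ` in `ℚ̄`. [folklore] -/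
def kramerRoot (d : ℚ) : AlgebraicClosure ℚ :=
  Classical.choose (IsAlgClosed.exists_eq_mul_self (algebraMap ℚ (AlgebraicClosure ℚ) d))

/-- `√d · √d = d`. [folklore] -/
theorem kramerRoot_mul_self (d : ℚ) :
    kramerRoot d * kramerRoot d = algebraMap ℚ (AlgebraicClosure ℚ) d :=
  (Classical.choose_spec (IsAlgClosed.exists_eq_mul_self (algebraMap ℚ (AlgebraicClosure ℚ) d))).symm

/-- `√d ≠ 0` for `d ≠ 0`. [folklore] -/
theorem kramerRoot_ne_zero {d : ℚ} (hd : d ≠ 0) : kramerRoot d ≠ 0 := fun h => by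
  have := kramerRoot_mul_self d
  rw [h, mul_zero] at this
  exact hd ((algebraMap ℚ (AlgebraicClosure ℚ)).injective (by rw [_root_.map_zero]; exact this.symm))

/-- A Galois automorphism sends `√d` to `±√d`. [folklore] -/
theorem galEquiv_kramerRoot (d : ℚ) (σ : Field.absoluteGaloisGroup ℚ) :
    galEquiv σ (kramerRoot d) = kramerRoot d ∨ galEquiv σ (kramerRoot d) = -kramerRoot d := by
  rw [← mul_self_eq_mul_self_iff, ← map_mul, kramerRoot_mul_self, AlgEquiv.commutes]

/-- The stabiliser of `√d` in `Γ_ℚ` is open (it contains `Gal(ℚ̄/ℚ(√d))`). [folklore] -/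
theorem isOpen_setOf_galEquiv_kramerRoot (d : ℚ) :
    IsOpen {σ : Field.absoluteGaloisGroup ℚ | galEquiv σ (kramerRoot d) = kramerRoot d} := by
  let E : IntermediateField ℚ (AlgebraicClosure ℚ) := IntermediateField.adjoin ℚ {kramerRoot d}
  haveI : FiniteDimensional ℚ E := IntermediateField.finiteDimensional_adjoin fun z _ =>
    @Algebra.IsIntegral.isIntegral ℚ (AlgebraicClosure ℚ) _ _ (AlgebraicClosure.instAlgebra ℚ) _ z
  let H : Subgroup (Field.absoluteGaloisGroup ℚ) := E.fixingSubgroup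
  have hHopen : IsOpen (H : Set (Field.absoluteGaloisGroup ℚ)) := E.fixingSubgroup_isOpen
  have hsub : (H : Set (Field.absoluteGaloisGroup ℚ)) ⊆
      {σ : Field.absoluteGaloisGroup ℚ | galEquiv σ (kramerRoot d) = kramerRoot d} := by
    intro σ hσ
    have hσ' : galEquiv σ ∈ E.fixingSubgroup := hσ
    rw [IntermediateField.mem_fixingSubgroup_iff] at hσ'
    exact hσ' _ (IntermediateField.subset_adjoin ℚ _ (Set.mem_singleton _))
  rw [isOpen_iff_mem_nhds]
  intro σ hσ
  have hopen : IsOpen ((fun τ => σ * τ) '' (H : Set (Field.absoluteGaloisGroup ℚ))) :=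
    (isOpenMap_mul_left σ) _ hHopen
  refine Filter.mem_of_superset (hopen.mem_nhds ⟨1, H.one_mem, mul_one σ⟩) ?_
  rintro _ ⟨τ, hτ, rfl⟩
  have hτ' := hsub hτ
  simp only [Set.mem_setOf_eq] at hσ hτ' ⊢
  rw [show galEquiv (σ * τ) = galEquiv σ * galEquiv τ from rfl, AlgEquiv.mul_apply, hτ', hσ]

/-- The complement of the stabiliser of `√d` is open as well (it is a union of cosets of an open
subgroup). [folklore] -/
theorem isOpen_setOf_galEquiv_kramerRoot_ne (d : ℚ) :
    IsOpen {σ : Field.absoluteGaloisGroup ℚ | ¬ galEquiv σ (kramerRoot d) = kramerRoot d} := by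
  let E : IntermediateField ℚ (AlgebraicClosure ℚ) := IntermediateField.adjoin ℚ {kramerRoot d}
  haveI : FiniteDimensional ℚ E := IntermediateField.finiteDimensional_adjoin fun z _ =>
    @Algebra.IsIntegral.isIntegral ℚ (AlgebraicClosure ℚ) _ _ (AlgebraicClosure.instAlgebra ℚ) _ z
  let H : Subgroup (Field.absoluteGaloisGroup ℚ) := E.fixingSubgroup
  have hHopen : IsOpen (H : Set (Field.absoluteGaloisGroup ℚ)) := E.fixingSubgroup_isOpen
  have hfix : ∀ τ ∈ (H : Set (Field.absoluteGaloisGroup ℚ)), galEquiv τ (kramerRoot d) = kramerRoot d := by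
    intro τ hτ
    have hτ' : galEquiv τ ∈ E.fixingSubgroup := hτ
    rw [IntermediateField.mem_fixingSubgroup_iff] at hτ'
    exact hτ' _ (IntermediateField.subset_adjoin ℚ _ (Set.mem_singleton _))
  rw [isOpen_iff_mem_nhds]
  intro σ hσ
  have hopen : IsOpen ((fun τ => σ * τ) '' (H : Set (Field.absoluteGaloisGroup ℚ))) :=
    (isOpenMap_mul_left σ) _ hHopen
  refine Filter.mem_of_superset (hopen.mem_nhds ⟨1, H.one_mem, mul_one σ⟩) ?_
  rintro _ ⟨τ, hτ, rfl⟩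
  simp only [Set.mem_setOf_eq] at hσ ⊢
  rw [show galEquiv (σ * τ) = galEquiv σ * galEquiv τ from rfl, AlgEquiv.mul_apply, hfix τ hτ]
  exact hσ

variable {m}

/-- The values `σ ↦ χ_d(σ) · T` of the quadratic cocycle attached to `d ∈ ℚ*`: `0` if `σ` fixes
`√d`, `T` otherwise (the image in `B(ℚ̄)` of the Kummer cocycle of `d` under
`ℚ*/ℚ*² = H¹(ℚ, μ₂) = H¹(ℚ, B_g)`, `B_g = {O, T}`; §3: "`H¹(K, B_g) = K*/K*²`").
[cite: Kramer1983, §3] -/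
def kramerPhiFun (hm : 0 < m) (d : ℚ) (σ : Field.absoluteGaloisGroup ℚ) :
    geomPoints (kramerCurveB (m : ℚ)) :=
  if galEquiv σ (kramerRoot d) = kramerRoot d then 0 else kramerTgeom hm

/-- `σ ↦ χ_d(σ) T` is continuous (locally constant). [folklore] -/
theorem continuous_kramerPhiFun (hm : 0 < m) (d : ℚ) : Continuous (kramerPhiFun hm d) := by
  refine Continuous.if ?_ continuous_const continuous_const
  intro σ hσ
  have hclopen : IsClopen {σ : Field.absoluteGaloisGroup ℚ | galEquiv σ (kramerRoot d) = kramerRoot d} :=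
    ⟨⟨isOpen_setOf_galEquiv_kramerRoot_ne d⟩, isOpen_setOf_galEquiv_kramerRoot d⟩
  rw [hclopen.frontier_eq] at hσ
  exact absurd hσ (Set.notMem_empty σ)

/-- `χ_d` is a character: `στ` fixes `√d` iff `σ` and `τ` both do or both do not. [folklore] -/
theorem galEquiv_mul_kramerRoot_iff {d : ℚ} (hd : d ≠ 0) (σ τ : Field.absoluteGaloisGroup ℚ) :
    galEquiv (σ * τ) (kramerRoot d) = kramerRoot d ↔
      (galEquiv σ (kramerRoot d) = kramerRoot d ↔ galEquiv τ (kramerRoot d) = kramerRoot d) := by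
  have hr := kramerRoot_ne_zero hd
  have hrr : kramerRoot d ≠ -kramerRoot d := fun h => hr (by
    have : (2 : AlgebraicClosure ℚ) * kramerRoot d = 0 := by linear_combination h
    simpa using this)
  rw [show galEquiv (σ * τ) = galEquiv σ * galEquiv τ from rfl, AlgEquiv.mul_apply]
  rcases galEquiv_kramerRoot d σ with hs | hs <;> rcases galEquiv_kramerRoot d τ with ht | ht
  · rw [ht, hs]
    exact iff_of_true rfl (iff_of_true rfl rfl)
  · rw [ht, map_neg, hs]
    exact iff_of_false (fun h => hrr h.symm) (fun h => hrr (h.mp rfl).symm)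
  · rw [ht, hs]
    exact iff_of_false (fun h => hrr h.symm) (fun h => hrr (h.mpr rfl).symm)
  · rw [ht, map_neg, hs, neg_neg]
    exact iff_of_true rfl (Iff.rfl)

/-- **The quadratic cocycle** `σ ↦ χ_d(σ) T` as a continuous crossed homomorphism
`Γ_ℚ → B(ℚ̄)` (a homomorphism to `{O, T} ⊆ B(ℚ)`, on which `Γ_ℚ` acts trivially).
[cite: Kramer1983, §3] -/
def kramerPhi (hm : 0 < m) {d : ℚ} (hd : d ≠ 0) :
    contOneCocycles (discreteTopRep (Field.absoluteGaloisGroup ℚ) (geomPoints (kramerCurveB (m : ℚ)))) :=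
  ⟨⟨kramerPhiFun hm d, continuous_kramerPhiFun hm d⟩, fun σ τ => by
    change kramerPhiFun hm d (σ * τ) = kramerPhiFun hm d σ + σ • kramerPhiFun hm d τ
    unfold kramerPhiFun
    have key := galEquiv_mul_kramerRoot_iff hd σ τ
    by_cases hs : galEquiv σ (kramerRoot d) = kramerRoot d <;>
      by_cases ht : galEquiv τ (kramerRoot d) = kramerRoot d
    · rw [if_pos (key.mpr (iff_of_true hs ht)), if_pos hs, if_pos ht, smul_zero, add_zero]
    · rw [if_neg (fun h => ht ((key.mp h).mp hs)), if_pos hs, if_neg ht, smul_kramerTgeom, zero_add]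
    · rw [if_neg (fun h => hs ((key.mp h).mpr ht)), if_neg hs, if_pos ht, smul_zero, add_zero]
    · rw [if_pos (key.mpr (iff_of_false hs ht)), if_neg hs, if_neg ht, smul_kramerTgeom,
        kramerTgeom_add_self]⟩

/-- Values of the quadratic cocycle. [folklore] -/
@[simp]
theorem kramerPhi_apply (hm : 0 < m) {d : ℚ} (hd : d ≠ 0) (σ : Field.absoluteGaloisGroup ℚ) :
    (kramerPhi hm hd).1 σ = kramerPhiFun hm d σ :=
  rfl

/-- **The class `ξ_d ∈ H¹(ℚ, B)`** of the quadratic cocycle — the image of `d ∈ ℚ*/ℚ*² = H¹(ℚ, B_g)`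
in `H¹(ℚ, B)` (§3, diagram (4); §5 (9)). [cite: Kramer1983, §3 (4) and §5 (9)] -/
def kramerXi (hm : 0 < m) {d : ℚ} (hd : d ≠ 0) : (kramerCurveB (m : ℚ)).galH1 :=
  oneCocycleClass _ (kramerPhi hm hd)

/-! ### `ξ` is a homomorphism `ℚ*/ℚ*² → H¹(ℚ, B)[2]` -/

/-- The class `ξ_d` only depends on `d`. [folklore] -/
theorem kramerXi_congr (hm : 0 < m) {d d' : ℚ} (hd : d ≠ 0) (hd' : d' ≠ 0) (h : d = d') :
    kramerXi hm hd = kramerXi hm hd' := by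
  subst h; rfl

/-- `2 ξ_d = 0`: the cocycle takes values in `{O, T} ⊆ B[2]`. [cite: Kramer1983, §5 (10)] -/
theorem two_nsmul_kramerXi (hm : 0 < m) {d : ℚ} (hd : d ≠ 0) : 2 • kramerXi hm hd = 0 := by
  unfold kramerXi
  refine nsmul_oneCocycleClass_eq_zero _ 2 fun σ => ?_
  rw [kramerPhi_apply, kramerPhiFun]
  split_ifs
  · exact smul_zero _
  · rw [two_nsmul, kramerTgeom_add_self]

/-- `ξ_d = 0` if `d` is a square in `ℚ` (then `√d ∈ ℚ` is fixed by `Γ_ℚ`). [folklore] -/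
theorem kramerXi_of_eq_mul_self (hm : 0 < m) {d : ℚ} (hd : d ≠ 0) (c : ℚ) (hc : d = c * c) :
    kramerXi hm hd = 0 := by
  have hr : kramerRoot d = algebraMap ℚ _ c ∨ kramerRoot d = -algebraMap ℚ _ c := by
    rw [← mul_self_eq_mul_self_iff, kramerRoot_mul_self, hc, map_mul]
  have hfix : ∀ σ : Field.absoluteGaloisGroup ℚ, galEquiv σ (kramerRoot d) = kramerRoot d := by
    intro σ
    rcases hr with h | h <;> rw [h]
    · exact AlgEquiv.commutes _ c
    · rw [map_neg, AlgEquiv.commutes]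
  unfold kramerXi
  rw [oneCocycleClass_eq_zero_iff]
  refine ⟨0, fun σ => ?_⟩
  change kramerPhiFun hm d σ = σ • (0 : geomPoints (kramerCurveB (m : ℚ))) - 0
  rw [smul_zero, sub_zero, kramerPhiFun, if_pos (hfix σ)]

/-- `χ_{dd′} = χ_d + χ_{d′}`: `σ` fixes `√(dd′) = ±√d √d′` iff it fixes both or neither of `√d`,
`√d′`. [folklore] -/
theorem galEquiv_kramerRoot_mul_iff {d d' : ℚ} (hd : d ≠ 0) (hd' : d' ≠ 0) (σ : Field.absoluteGaloisGroup ℚ) :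
    galEquiv σ (kramerRoot (d * d')) = kramerRoot (d * d') ↔
      (galEquiv σ (kramerRoot d) = kramerRoot d ↔ galEquiv σ (kramerRoot d') = kramerRoot d') := by
  have hr := kramerRoot_ne_zero hd
  have hr' := kramerRoot_ne_zero hd'
  have hprod : kramerRoot (d * d') = kramerRoot d * kramerRoot d' ∨
      kramerRoot (d * d') = -(kramerRoot d * kramerRoot d') := by
    rw [← mul_self_eq_mul_self_iff, kramerRoot_mul_self, map_mul, ← kramerRoot_mul_self d,
      ← kramerRoot_mul_self d']
    ring
  have key : galEquiv σ (kramerRoot d * kramerRoot d') = kramerRoot d * kramerRoot d' ↔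
      (galEquiv σ (kramerRoot d) = kramerRoot d ↔ galEquiv σ (kramerRoot d') = kramerRoot d') := by
    rw [map_mul]
    rcases galEquiv_kramerRoot d σ with hs | hs <;> rcases galEquiv_kramerRoot d' σ with ht | ht <;>
      rw [hs, ht]
    · exact iff_of_true rfl (iff_of_true rfl rfl)
    · refine iff_of_false (fun h => ?_) (fun h => hr' (CharZero.neg_eq_self_iff.mp (h.mp rfl)))
      have : kramerRoot d * kramerRoot d' = 0 := by
        apply CharZero.neg_eq_self_iff.mp; linear_combination h
      exact (mul_ne_zero hr hr') this
    · refine iff_of_false (fun h => ?_) (fun h => hr (CharZero.neg_eq_self_iff.mp (h.mpr rfl)))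
      have : kramerRoot d * kramerRoot d' = 0 := by
        apply CharZero.neg_eq_self_iff.mp; linear_combination h
      exact (mul_ne_zero hr hr') this
    · exact iff_of_true (by ring) (iff_of_false (fun h => hr (CharZero.neg_eq_self_iff.mp h))
        (fun h => hr' (CharZero.neg_eq_self_iff.mp h)))
  rcases hprod with h | h
  · rw [h]; exact key
  · rw [h, map_neg, neg_inj]; exact key

/-- **Additivity of the cocycles**: `φ_{dd′} = φ_d + φ_{d′}`. [folklore] -/
theorem kramerPhi_mul (hm : 0 < m) {d d' : ℚ} (hd : d ≠ 0) (hd' : d' ≠ 0) :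
    kramerPhi hm (mul_ne_zero hd hd') = kramerPhi hm hd + kramerPhi hm hd' := by
  apply Subtype.ext
  ext σ
  change kramerPhiFun hm (d * d') σ = kramerPhiFun hm d σ + kramerPhiFun hm d' σ
  unfold kramerPhiFun
  have key := galEquiv_kramerRoot_mul_iff hd hd' σ
  by_cases hs : galEquiv σ (kramerRoot d) = kramerRoot d <;>
    by_cases ht : galEquiv σ (kramerRoot d') = kramerRoot d'
  · rw [if_pos (key.mpr (iff_of_true hs ht)), if_pos hs, if_pos ht, add_zero]
  · rw [if_neg (fun h => ht ((key.mp h).mp hs)), if_pos hs, if_neg ht, zero_add]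
  · rw [if_neg (fun h => hs ((key.mp h).mpr ht)), if_neg hs, if_pos ht, add_zero]
  · rw [if_pos (key.mpr (iff_of_false hs ht)), if_neg hs, if_neg ht, kramerTgeom_add_self]

/-- **`ξ_{dd′} = ξ_d + ξ_{d′}`** (`H¹(K, B_g) = K*/K*²` is an isomorphism of groups, §3).
[cite: Kramer1983, §3] -/
theorem kramerXi_mul (hm : 0 < m) {d d' : ℚ} (hd : d ≠ 0) (hd' : d' ≠ 0) :
    kramerXi hm (mul_ne_zero hd hd') = kramerXi hm hd + kramerXi hm hd' := by
  unfold kramerXi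
  rw [kramerPhi_mul, oneCocycleClass_add]

/-- `ξ` on `ℚˣ`, as a monoid homomorphism into `Multiplicative H¹(ℚ, B)`. [folklore] -/
def kramerXiUnits (hm : 0 < m) : ℚˣ →* Multiplicative ((kramerCurveB (m : ℚ)).galH1) where
  toFun u := Multiplicative.ofAdd (kramerXi hm u.ne_zero)
  map_one' := by
    rw [kramerXi_of_eq_mul_self hm (1 : ℚˣ).ne_zero 1 (by simp)]
    rfl
  map_mul' u v := by
    rw [← ofAdd_add, ← kramerXi_mul]

/-- Values of `kramerXiUnits`. [folklore] -/
theorem kramerXiUnits_apply (hm : 0 < m) (u : ℚˣ) :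
    kramerXiUnits hm u = Multiplicative.ofAdd (kramerXi hm u.ne_zero) :=
  rfl

/-- `ξ` kills squares of `ℚˣ`. [folklore] -/
theorem range_powMonoidHom_le_ker (hm : 0 < m) :
    (powMonoidHom 2 : ℚˣ →* ℚˣ).range ≤ (kramerXiUnits hm).ker := by
  rintro _ ⟨u, rfl⟩
  rw [MonoidHom.mem_ker, kramerXiUnits_apply,
    kramerXi_of_eq_mul_self hm _ (u : ℚ) (by rw [powMonoidHom_apply]; push_cast; ring)]
  rfl

/-- **`Ξ : ℚ*/ℚ*² → H¹(ℚ, B)`**, `[d] ↦ ξ_d` — the map `H¹(ℚ, B_g) → H¹(ℚ, B)` of diagram (4)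
(§3: "`H¹(K, B_g) = K*/K*²`"). [cite: Kramer1983, §3 (4) and §5 (9)] -/
def kramerXiHom (hm : 0 < m) : Additive (SqUnits ℚ) →+ (kramerCurveB (m : ℚ)).galH1 :=
  MonoidHom.toAdditiveLeft (QuotientGroup.lift _ (kramerXiUnits hm) (range_powMonoidHom_le_ker hm))

/-- `Ξ [d] = ξ_d`. [folklore] -/
theorem kramerXiHom_sqClass (hm : 0 < m) {d : ℚ} (hd : d ≠ 0) :
    kramerXiHom hm (Additive.ofMul (sqClass d)) = kramerXi hm hd := by
  rw [sqClass_of_ne_zero hd, kramerXiHom, MonoidHom.coe_toAdditiveLeft]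
  rfl

end Cocycle

/-! ### Coordinate functions under ring homomorphisms -/

section MapLemmas

variable {F F' : Type*} [Field F] [Field F'] {G : Type*} [FunLike G F F'] [RingHomClass G F F']

/-- `f (μ(X, Y)) = μ(f X, f Y)`. [folklore] -/
theorem map_kramerMu (f : G) (X Y : F) : f (kramerMu X Y) = kramerMu (f X) (f Y) := by
  simp only [kramerMu, map_mul, map_inv₀, map_add, map_one, map_ofNat]

/-- `f (x(g(X, Y))) = x(g(f X, f Y))`. [folklore] -/
theorem map_kramerGX (f : G) (X Y : F) : f (kramerGX X Y) = kramerGX (f X) (f Y) := by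
  simp only [kramerGX, map_pow, map_kramerMu]

/-- `f (y(g(X, Y))) = y(g(f X, f Y))`. [folklore] -/
theorem map_kramerGY (f : G) (X Y : F) : f (kramerGY X Y) = kramerGY (f X) (f Y) := by
  simp only [kramerGY, map_sub, map_div₀, map_mul, map_inv₀, map_pow, map_add, map_one, map_ofNat,
    map_kramerMu]

/-- `f (D(μ)) = D(f μ)` for parameters in the base. [folklore] -/
theorem map_kramerQden (f : G) (m x₀ y₀ μ : F) :
    f (kramerQden m x₀ y₀ μ) = kramerQden (f m) (f x₀) (f y₀) (f μ) := by
  simp only [kramerQden, map_add, map_mul, map_div₀, map_ofNat, map_one]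

/-- `f (X(Q(μ))) = X(Q(f μ))`. [folklore] -/
theorem map_kramerQX (f : G) (m x₀ y₀ μ : F) :
    f (kramerQX m x₀ y₀ μ) = kramerQX (f m) (f x₀) (f y₀) (f μ) := by
  simp only [kramerQX, map_sub, map_mul, map_inv₀, map_div₀, map_ofNat, map_one, map_kramerQden]

/-- `f (Y(Q(μ))) = Y(Q(f μ))`. [folklore] -/
theorem map_kramerQY (f : G) (m x₀ y₀ μ : F) :
    f (kramerQY m x₀ y₀ μ) = kramerQY (f m) (f x₀) (f y₀) (f μ) := by
  simp only [kramerQY, map_sub, map_mul, map_inv₀, map_div₀, map_ofNat, map_kramerQden, map_kramerQX]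

end MapLemmas

/-! ### The kernel of `Ξ`: classes dying in `H¹(ℚ, B)` come from `A(ℚ)` -/

section Kernel

open Literature.NumberTheory.GaloisRepresentations

variable {m : ℕ}

/-- `A.baseChange L` is `A_m` over `L`. [folklore] -/
theorem kramerCurveA_baseChange (m : ℕ) (L : Type*) [Field L] [Algebra ℚ L] :
    (kramerCurveA (m : ℚ)).baseChange L = kramerCurveA ((m : ℕ) : L) := by
  rw [WeierstrassCurve.baseChange, map_kramerCurveA, map_natCast]

/-- `A_m` is elliptic when `m (16m+1) ≠ 0`. [cite: Kramer1983, §5 (11)] -/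
theorem isElliptic_kramerCurveA_of_ne {F : Type*} [Field F] (m : F) (hm : m * (16 * m + 1) ≠ 0) :
    (kramerCurveA m).IsElliptic := by
  rw [WeierstrassCurve.isElliptic_iff, kramerCurveA_Δ, isUnit_iff_ne_zero]
  obtain ⟨h1, h2⟩ := mul_ne_zero_iff.mp hm
  exact mul_ne_zero (pow_ne_zero _ h1) (pow_ne_zero _ h2)

/-- A point of `A_m` satisfying the equation is nonsingular (`A_m` elliptic). [folklore] -/
theorem nonsingular_kramerCurveA_of_equation {F : Type*} [Field F] {m : F} (hm : m * (16 * m + 1) ≠ 0)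
    {x y : F} (h : (kramerCurveA m).toAffine.Equation x y) : (kramerCurveA m).toAffine.Nonsingular x y := by
  haveI := isElliptic_kramerCurveA_of_ne m hm
  exact (WeierstrassCurve.Affine.equation_iff_nonsingular).mp h

/-- `T₁ = (0, 0)` is a nonsingular point of `A_m(ℚ)`. [cite: Kramer1983, §5 (p. 383)] -/
theorem nonsingular_kramerCurveA_zero (hm : 0 < m) : (kramerCurveA (m : ℚ)).toAffine.Nonsingular 0 0 :=
  nonsingular_kramerCurveA_of_equation (kramer_hm hm) (equation_kramerCurveA_zero _)

/-- `γ(O) = 1` (generic-field form, avoiding instance clashes at `F = ℚ`). [cite: Kramer1983, §3 (4)–(6)] -/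
theorem kramerGamma_apply_zero {F : Type*} [Field F] (m : F) : kramerGamma m 0 = 1 :=
  twoDescentComponent_zero

/-- `γ(T₁) = [t₂ t₃]`. [cite: Kramer1983, §3 (4)–(6)] -/
theorem kramerGamma_apply_some_eq {F : Type*} [Field F] (m : F) {x y : F}
    (h : (kramerCurveA m).toAffine.Nonsingular x y) (hx : x = 0) :
    kramerGamma m (.some x y h) = sqClass ((0 - -(4 * m)) * (0 - -(16 * m + 1) / 4)) :=
  twoDescentComponent_some_of_eq h hx

/-- `γ(P) = [x(P)]` for `x(P) ≠ 0`. [cite: Kramer1983, §3 (4)–(6)] -/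
theorem kramerGamma_apply_some_ne {F : Type*} [Field F] (m : F) {x y : F}
    (h : (kramerCurveA m).toAffine.Nonsingular x y) (hx : x ≠ 0) :
    kramerGamma m (.some x y h) = sqClass (x - 0) :=
  twoDescentComponent_some_of_ne h hx

/-- In `Fˣ/Fˣ²`: `g h = 1` forces `g = h`. [folklore] -/
theorem sqUnits_eq_of_mul_eq_one {F : Type*} [Field F] {g h : SqUnits F} (hgh : g * h = 1) : g = h := by
  calc g = g * (h * h) := by rw [SqUnits.mul_self]; exact (SqUnits.mul_one g).symm
    _ = (g * h) * h := by rw [mul_assoc]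
    _ = h := by rw [hgh]; exact SqUnits.one_mul h

/-- Two non-zero field elements whose product is a square have the same square class.
[folklore] -/
theorem sqClass_eq_of_mul_eq_square {F : Type*} [Field F] {a b w : F} (ha : a ≠ 0) (hb : b ≠ 0)
    (h : a * b = w ^ 2) : sqClass a = sqClass b :=
  sqUnits_eq_of_mul_eq_one (by rw [← sqClass_mul ha hb, h, sqClass_sq])

/-- `T ≠ O` in `B(ℚ̄)`. [folklore] -/
theorem kramerTgeom_ne_zero (hm : 0 < m) : kramerTgeom hm ≠ 0 := by
  intro h
  cases h

/-- An element of `ℚ̄` fixed by `Γ_ℚ` is rational (Galois descent; `ℚ̄/ℚ` is Galois). [folklore] -/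
theorem exists_algebraMap_eq_of_forall_galEquiv {x : AlgebraicClosure ℚ}
    (hx : ∀ σ : Field.absoluteGaloisGroup ℚ, galEquiv σ x = x) :
    ∃ c : ℚ, algebraMap ℚ (AlgebraicClosure ℚ) c = x := by
  haveI : Algebra.IsAlgebraic ℚ (AlgebraicClosure ℚ) :=
    @IsAlgClosure.isAlgebraic ℚ (AlgebraicClosure ℚ) _ _ (AlgebraicClosure.instAlgebra ℚ) _ inferInstance
  haveI : Algebra.IsSeparable ℚ (AlgebraicClosure ℚ) := Algebra.IsAlgebraic.isSeparable_of_perfectField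
  haveI : Normal ℚ (AlgebraicClosure ℚ) :=
    @IsAlgClosure.normal ℚ (AlgebraicClosure ℚ) _ _ (AlgebraicClosure.instAlgebra ℚ) inferInstance
  haveI : IsGalois ℚ (AlgebraicClosure ℚ) := {}
  exact (InfiniteGalois.mem_range_algebraMap_iff_fixed x).mpr fun σ => hx σ

/-- If every `σ ∈ Γ_ℚ` fixes `√d` then `d` is a square in `ℚ`. [folklore] -/
theorem exists_eq_mul_self_of_forall_fix {d : ℚ}
    (hfix : ∀ σ : Field.absoluteGaloisGroup ℚ, galEquiv σ (kramerRoot d) = kramerRoot d) :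
    ∃ c : ℚ, d = c * c := by
  obtain ⟨c, hc⟩ := exists_algebraMap_eq_of_forall_galEquiv hfix
  exact ⟨c, (algebraMap ℚ (AlgebraicClosure ℚ)).injective (by rw [map_mul, hc, kramerRoot_mul_self])⟩

/-- A Galois automorphism moving `√d` sends it to `−√d`, and does not fix it. [folklore] -/
theorem not_fix_of_galEquiv_eq_neg {d : ℚ} (hd : d ≠ 0) {σ : Field.absoluteGaloisGroup ℚ}
    (hs : galEquiv σ (kramerRoot d) = -kramerRoot d) : ¬ galEquiv σ (kramerRoot d) = kramerRoot d := fun h =>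
  kramerRoot_ne_zero hd (CharZero.neg_eq_self_iff.mp (hs.symm.trans h))

/-- **The kernel of `Ξ`**: if `ξ_d = 0` in `H¹(ℚ, B)` then `[d] ∈ γ(A(ℚ))` — exactness of
`A(ℚ) → H¹(ℚ, B_g) → H¹(ℚ, B)` (diagram (4), sequence (9)): a coboundary `χ_d(σ)T = σ v − v`,
`v ∈ B(ℚ̄)`, gives the rational point `g(v) ∈ A(ℚ)` with `γ(g(v)) = x(g(v)) = μ(v)² ≡ d`
(`σ μ(v) = χ_d(σ) μ(v)` since `μ(v + T) = −μ(v)`); the `2`-torsion `v` give `T₁`, and `v ∈ {O, T}`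
give squares. [cite: Kramer1983, §3 (4) and §5 (9)] -/
theorem sqClass_mem_range_of_kramerXi_eq_zero (hm : 0 < m) {d : ℚ} (hd : d ≠ 0)
    (h0 : kramerXi hm hd = 0) : sqClass d ∈ Set.range (kramerGamma (m : ℚ)) := by
  -- the coboundary
  obtain ⟨v, hv⟩ := (oneCocycleClass_eq_zero_iff _ _).mp h0
  have hv' : ∀ σ : Field.absoluteGaloisGroup ℚ, kramerPhiFun hm d σ = σ • v - v := hv
  -- squares
  have square_case : (∀ σ : Field.absoluteGaloisGroup ℚ, galEquiv σ (kramerRoot d) = kramerRoot d) →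
      sqClass d ∈ Set.range (kramerGamma (m : ℚ)) := by
    intro hfix
    obtain ⟨c, hc⟩ := exists_eq_mul_self_of_forall_fix hfix
    refine ⟨0, ?_⟩
    rw [kramerGamma_apply_zero, hc, sqClass_mul_self]
  -- facts over `L = ℚ̄`
  have hW := kramerCurveB_baseChange m (AlgebraicClosure ℚ)
  have hmL := kramer_hm_cast hm (AlgebraicClosure ℚ)
  rcases v with _ | ⟨X, Y, hXY⟩
  · -- `v = O`: the cocycle is identically `0`, so every `σ` fixes `√d`
    refine square_case fun σ => ?_
    by_contra hs
    have := hv' σ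
    rw [kramerPhiFun, if_neg hs] at this
    exact kramerTgeom_ne_zero hm (by rw [this]; exact sub_self _)
  · have hEL : (kramerCurveB ((m : ℕ) : AlgebraicClosure ℚ)).toAffine.Equation X Y := by
      rw [← hW]; exact hXY.left
    by_cases hXq : X = -1 / 4
    · -- `v = T`: again the cocycle vanishes
      subst hXq
      have hY : Y = 1 / 8 := by
        rcases Y_eq_of_X_eq hXY.left (nonsingular_Tgeom hm).left rfl with h | h
        · exact h
        · rw [h]; exact negY_T_of_eq hW
      subst hY
      refine square_case fun σ => ?_
      by_contra hs
      have := hv' σ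
      rw [kramerPhiFun, if_neg hs, show (Point.some (-1 / 4) (1 / 8) hXY :
        geomPoints (kramerCurveB (m : ℚ))) = kramerTgeom hm from rfl, smul_kramerTgeom, sub_self] at this
      exact kramerTgeom_ne_zero hm this
    · -- the main case: `σ v = v` or `σ v = v + T` according to `χ_d(σ)`
      set v : geomPoints (kramerCurveB (m : ℚ)) := Point.some X Y hXY with hvdef
      have h3 := nonsingular_tr_of_eq hW hmL hXY hXq
      have hvT : kramerTgeom hm + v = Point.some (kramerTrX X) (kramerTrY X Y) h3 := by
        rw [add_comm, hvdef]
        exact some_add_T_of_eq hW hmL hXY hXq _ h3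
      have hfix : ∀ σ : Field.absoluteGaloisGroup ℚ, galEquiv σ (kramerRoot d) = kramerRoot d →
          galEquiv σ X = X ∧ galEquiv σ Y = Y := by
        intro σ hs
        have := hv' σ
        rw [kramerPhiFun, if_pos hs] at this
        have e : σ • v = v := sub_eq_zero.mp this.symm
        rw [hvdef, smul_geomPoints_some σ hXY (nonsingular_galEquiv σ hXY)] at e
        exact Point.some.inj e
      have hmov : ∀ σ : Field.absoluteGaloisGroup ℚ, ¬ galEquiv σ (kramerRoot d) = kramerRoot d →
          galEquiv σ X = kramerTrX X ∧ galEquiv σ Y = kramerTrY X Y := by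
        intro σ hs
        have := hv' σ
        rw [kramerPhiFun, if_neg hs] at this
        have e : σ • v = kramerTgeom hm + v := sub_eq_iff_eq_add.mp this.symm
        rw [hvT, hvdef, smul_geomPoints_some σ hXY (nonsingular_galEquiv σ hXY)] at e
        exact Point.some.inj e
      by_cases h2 : 2 * Y + X = 0
      · -- `v` is a `2`-torsion point `≠ T`: `[d] = [m(16m+1)] = γ(T₁)`
        have hρ := sq_eq_of_twoTorsion hEL h2 hXq
        set ρ := (X - 8 * ((m : ℕ) : AlgebraicClosure ℚ)) / 2 with hρdef
        have hX8 : X = 8 * ((m : ℕ) : AlgebraicClosure ℚ) + 2 * ρ := by rw [hρdef]; ring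
        have hσρ_fix : ∀ σ : Field.absoluteGaloisGroup ℚ, galEquiv σ X = X → galEquiv σ ρ = ρ := by
          intro σ hx
          rw [hρdef, map_div₀, map_sub, map_mul, map_ofNat, map_natCast, map_ofNat, hx]
        have hσρ_mov : ∀ σ : Field.absoluteGaloisGroup ℚ, galEquiv σ X = kramerTrX X → galEquiv σ ρ = -ρ := by
          intro σ hx
          rw [hX8, kramerTrX_of_twoTorsion hρ] at hx
          have : galEquiv σ ρ = (galEquiv σ (8 * ((m : ℕ) : AlgebraicClosure ℚ) + 2 * ρ) -
              8 * ((m : ℕ) : AlgebraicClosure ℚ)) / 2 := by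
            rw [map_add, map_mul, map_mul, map_ofNat, map_ofNat, map_natCast]; ring
          rw [this, hx]; ring
        have hinv : ∀ σ : Field.absoluteGaloisGroup ℚ,
            galEquiv σ (ρ * kramerRoot d) = ρ * kramerRoot d := by
          intro σ
          rw [map_mul]
          rcases galEquiv_kramerRoot d σ with hs | hs
          · rw [hs, hσρ_fix σ (hfix σ hs).1]
          · rw [hs, hσρ_mov σ (hmov σ (not_fix_of_galEquiv_eq_neg hd hs)).1]; ring
        obtain ⟨c, hc⟩ := exists_algebraMap_eq_of_forall_galEquiv hinv
        have hcd : (m : ℚ) * (16 * m + 1) * d = c ^ 2 := by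
          apply (algebraMap ℚ (AlgebraicClosure ℚ)).injective
          rw [map_pow, hc, mul_pow, hρ, pow_two (kramerRoot d), kramerRoot_mul_self]
          simp only [map_mul, map_add, map_one, map_natCast, map_ofNat]
        refine ⟨Point.some 0 0 (nonsingular_kramerCurveA_zero hm), ?_⟩
        rw [kramerGamma_apply_some_eq _ _ rfl,
          show (0 - -(4 * (m : ℚ))) * (0 - -(16 * (m : ℚ) + 1) / 4) = (m : ℚ) * (16 * m + 1) by ring]
        exact sqClass_eq_of_mul_eq_square (kramer_hm hm) hd hcd
      · -- the generic case: `x(g(v)) = μ² ≡ d`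
        have hD : 4 * X + 1 ≠ 0 := fun h0 => hXq (by linear_combination h0 / 4)
        have hμ0 : kramerMu X Y ≠ 0 := mul_ne_zero h2 (inv_ne_zero hD)
        have hσμ_fix : ∀ σ : Field.absoluteGaloisGroup ℚ, galEquiv σ (kramerRoot d) = kramerRoot d →
            galEquiv σ (kramerMu X Y) = kramerMu X Y := by
          intro σ hs
          obtain ⟨hx, hy⟩ := hfix σ hs
          rw [map_kramerMu, hx, hy]
        have hσμ_mov : ∀ σ : Field.absoluteGaloisGroup ℚ, ¬ galEquiv σ (kramerRoot d) = kramerRoot d →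
            galEquiv σ (kramerMu X Y) = -kramerMu X Y := by
          intro σ hs
          obtain ⟨hx, hy⟩ := hmov σ hs
          rw [map_kramerMu, hx, hy, kramerMu_tr hXq]
        -- `μ √d`, `x(g v) = μ²` and `y(g v)` are `Γ_ℚ`-invariant
        have hinv : ∀ σ : Field.absoluteGaloisGroup ℚ,
            galEquiv σ (kramerMu X Y * kramerRoot d) = kramerMu X Y * kramerRoot d := by
          intro σ
          rw [map_mul]
          rcases galEquiv_kramerRoot d σ with hs | hs
          · rw [hs, hσμ_fix σ hs]
          · rw [hs, hσμ_mov σ (not_fix_of_galEquiv_eq_neg hd hs)]; ring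
        have hinvX : ∀ σ : Field.absoluteGaloisGroup ℚ, galEquiv σ (kramerGX X Y) = kramerGX X Y := by
          intro σ
          rw [map_kramerGX]
          by_cases hs : galEquiv σ (kramerRoot d) = kramerRoot d
          · obtain ⟨hx, hy⟩ := hfix σ hs; rw [hx, hy]
          · obtain ⟨hx, hy⟩ := hmov σ hs; rw [hx, hy, kramerGX_tr hXq]
        have hinvY : ∀ σ : Field.absoluteGaloisGroup ℚ, galEquiv σ (kramerGY X Y) = kramerGY X Y := by
          intro σ
          rw [map_kramerGY]
          by_cases hs : galEquiv σ (kramerRoot d) = kramerRoot d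
          · obtain ⟨hx, hy⟩ := hfix σ hs; rw [hx, hy]
          · obtain ⟨hx, hy⟩ := hmov σ hs; rw [hx, hy, kramerGY_tr hXq]
        obtain ⟨c, hc⟩ := exists_algebraMap_eq_of_forall_galEquiv hinv
        obtain ⟨x₀, hx₀⟩ := exists_algebraMap_eq_of_forall_galEquiv hinvX
        obtain ⟨y₀, hy₀⟩ := exists_algebraMap_eq_of_forall_galEquiv hinvY
        -- the rational point `(x₀, y₀) ∈ A(ℚ)`
        have hAL : (kramerCurveA ((m : ℕ) : AlgebraicClosure ℚ)).toAffine.Equation (kramerGX X Y) (kramerGY X Y) :=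
          equation_kramerCurveA_g hEL hXq
        have hA0 : (kramerCurveA (m : ℚ)).toAffine.Equation x₀ y₀ := by
          have h1 : ((kramerCurveA (m : ℚ)).baseChange (AlgebraicClosure ℚ)).toAffine.Equation
              (Algebra.ofId ℚ (AlgebraicClosure ℚ) x₀) (Algebra.ofId ℚ (AlgebraicClosure ℚ) y₀) := by
            rw [kramerCurveA_baseChange, Algebra.ofId_apply, Algebra.ofId_apply, hx₀, hy₀]; exact hAL
          have hinj : Function.Injective (Algebra.ofId ℚ (AlgebraicClosure ℚ)) :=
            (algebraMap ℚ (AlgebraicClosure ℚ)).injective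
          exact ((kramerCurveA (m : ℚ)).toAffine.baseChange_equation hinj x₀ y₀).mp h1
        have hx0 : x₀ ≠ 0 := by
          intro h
          apply pow_ne_zero 2 hμ0
          rw [← kramerGX, ← hx₀, h, _root_.map_zero]
        have hxd : x₀ * d = c ^ 2 := by
          apply (algebraMap ℚ (AlgebraicClosure ℚ)).injective
          rw [map_mul, map_pow, hx₀, hc, kramerGX, mul_pow, ← kramerRoot_mul_self, pow_two (kramerRoot d)]
        refine ⟨Point.some x₀ y₀ (nonsingular_kramerCurveA_of_equation (kramer_hm hm) hA0), ?_⟩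
        rw [kramerGamma_apply_some_ne _ _ hx0, sub_zero]
        exact sqClass_eq_of_mul_eq_square hx0 hd hxd

end Kernel

/-! ### The local conditions: `ξ_d` restricts to `0` wherever `[d] ∈ γ(A(ℚ_v))` -/

section Local

open Literature.NumberTheory.GaloisRepresentations

variable {m : ℕ} (E : Type) [Field E] [Algebra ℚ E]

/-- An element of `Γ_E` as an automorphism of `Ē` (by definition). [folklore] -/
def galEquivE (τ : Field.absoluteGaloisGroup E) : AlgebraicClosure E ≃ₐ[E] AlgebraicClosure E := τ

variable {E}

/-- `ι ∘ (σ|_ℚ̄) = τ ∘ ι` for the restriction `Γ_E → Γ_ℚ` attached to `ι = closureEmb E`.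
[folklore] -/
theorem closureEmb_galEquiv_resGal (τ : Field.absoluteGaloisGroup E) (x : AlgebraicClosure ℚ) :
    closureEmb (K := ℚ) E (galEquiv (resGal (K := ℚ) E τ) x) = galEquivE E τ (closureEmb (K := ℚ) E x) :=
  apply_resGalAuxOfEmb_apply (closureEmb (K := ℚ) E) τ x

/-- The local Galois action on an affine local point acts on coordinates. [folklore] -/
theorem smul_localPoints_some {W : WeierstrassCurve ℚ} (τ : Field.absoluteGaloisGroup E)
    {x y : AlgebraicClosure E} (h : (W.baseChange (AlgebraicClosure E)).toAffine.Nonsingular x y)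
    (h' : (W.baseChange (AlgebraicClosure E)).toAffine.Nonsingular (galEquivE E τ x) (galEquivE E τ y)) :
    τ • (show localPoints W E from Point.some x y h) = Point.some (galEquivE E τ x) (galEquivE E τ y) h' := by
  rw [localPoints.smul_def]
  change Affine.Point.map _ (Point.some x y h) = _
  rw [Affine.Point.map_some]
  rfl

/-- Nonsingularity is preserved by the local Galois action. [folklore] -/
theorem nonsingular_galEquivE {W : WeierstrassCurve ℚ} (τ : Field.absoluteGaloisGroup E)
    {x y : AlgebraicClosure E} (h : (W.baseChange (AlgebraicClosure E)).toAffine.Nonsingular x y) :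
    (W.baseChange (AlgebraicClosure E)).toAffine.Nonsingular (galEquivE E τ x) (galEquivE E τ y) :=
  (W.toAffine.baseChange_nonsingular
    ((AlgEquiv.restrictScalars ℚ (galEquivE E τ)) :
      AlgebraicClosure E →ₐ[ℚ] AlgebraicClosure E).injective ..).mpr h

/-- `pointsMap` acts on coordinates through `closureEmb`. [folklore] -/
theorem pointsMap_some {W : WeierstrassCurve ℚ} {x y : AlgebraicClosure ℚ}
    (h : (W.baseChange (AlgebraicClosure ℚ)).toAffine.Nonsingular x y)
    (h' : (W.baseChange (AlgebraicClosure E)).toAffine.Nonsingular (closureEmb (K := ℚ) E x)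
      (closureEmb (K := ℚ) E y)) :
    pointsMap W E (show geomPoints W from Point.some x y h) =
      (show localPoints W E from Point.some (closureEmb (K := ℚ) E x) (closureEmb (K := ℚ) E y) h') :=
  rfl

/-- `T` is nonsingular on `B.baseChange Ē`. [folklore] -/
theorem nonsingular_TE (hm : 0 < m) :
    ((kramerCurveB (m : ℚ)).baseChange (AlgebraicClosure E)).toAffine.Nonsingular (-1 / 4) (1 / 8) := by
  have hW := kramerCurveB_baseChange m (AlgebraicClosure E)
  haveI : CharZero E := charZero_of_injective_algebraMap (algebraMap ℚ E).injective
  haveI : CharZero (AlgebraicClosure E) :=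
    charZero_of_injective_algebraMap (algebraMap E (AlgebraicClosure E)).injective
  exact nonsingular_T_of_eq hW (kramer_hm_cast hm _)

/-- The image of `T` in `B(Ē)` is the point `(−1/4, 1/8)`. [folklore] -/
theorem pointsMap_kramerTgeom (hm : 0 < m) :
    pointsMap (kramerCurveB (m : ℚ)) E (kramerTgeom hm) =
      (show localPoints (kramerCurveB (m : ℚ)) E from Point.some (-1 / 4) (1 / 8) (nonsingular_TE hm)) := by
  have h' : ((kramerCurveB (m : ℚ)).baseChange (AlgebraicClosure E)).toAffine.Nonsingular
      (closureEmb (K := ℚ) E (-1 / 4 : AlgebraicClosure ℚ)) (closureEmb (K := ℚ) E (1 / 8)) := by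
    rw [map_div₀, map_neg, map_one, map_ofNat, map_div₀, map_one, map_ofNat]; exact nonsingular_TE hm
  unfold kramerTgeom
  rw [pointsMap_some (nonsingular_Tgeom hm) h']
  exact Point_some_ext (by rw [map_div₀, map_neg, map_one, map_ofNat]) (by rw [map_div₀, map_one, map_ofNat])

/-- Equal square classes have square product. [folklore] -/
theorem exists_mul_eq_sq_of_sqClass_eq {F : Type*} [Field F] {a b : F} (ha : a ≠ 0) (hb : b ≠ 0)
    (h : sqClass a = sqClass b) : ∃ w : F, a * b = w ^ 2 :=
  (sqClass_eq_one_iff (mul_ne_zero ha hb)).mp (by rw [sqClass_mul ha hb, h, SqUnits.mul_self])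

omit [Algebra ℚ E] in
/-- An `E`-automorphism of `Ē` sends a square root of an element of `E` to `±` itself. [folklore] -/
theorem galEquivE_root (τ : Field.absoluteGaloisGroup E) {s : AlgebraicClosure E} {e : E}
    (hs : s * s = algebraMap E (AlgebraicClosure E) e) :
    galEquivE E τ s = s ∨ galEquivE E τ s = -s := by
  rw [← mul_self_eq_mul_self_iff, ← map_mul, hs, AlgEquiv.commutes]

omit [Algebra ℚ E] in
/-- `w/√d`: for `e dE = w²` in `E` (`dE` the image of `d`, `s = √d ∈ Ē`), `ν = w/s` has `ν² = e`,
is fixed by the `τ` fixing `s` and negated by the others. [folklore] -/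
theorem root_ratio [CharZero E] {s : AlgebraicClosure E} {dE e w : E} (hdE : dE ≠ 0)
    (hs2 : s * s = algebraMap E (AlgebraicClosure E) dE) (hw : e * dE = w ^ 2) :
    (algebraMap E (AlgebraicClosure E) w * s⁻¹) ^ 2 = algebraMap E (AlgebraicClosure E) e ∧
    (∀ τ : Field.absoluteGaloisGroup E, galEquivE E τ s = s →
      galEquivE E τ (algebraMap E (AlgebraicClosure E) w * s⁻¹) = algebraMap E (AlgebraicClosure E) w * s⁻¹) ∧
    (∀ τ : Field.absoluteGaloisGroup E, galEquivE E τ s = -s →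
      galEquivE E τ (algebraMap E (AlgebraicClosure E) w * s⁻¹) = -(algebraMap E (AlgebraicClosure E) w * s⁻¹)) := by
  refine ⟨?_, fun τ hτ => ?_, fun τ hτ => ?_⟩
  · rw [mul_pow, inv_pow, pow_two s, hs2, ← map_pow, ← hw, map_mul, ← map_inv₀, mul_assoc, ← map_mul,
      mul_inv_cancel₀ hdE, map_one, mul_one]
  · rw [map_mul, AlgEquiv.commutes, map_inv₀, hτ]
  · rw [map_mul, AlgEquiv.commutes, map_inv₀, hτ, inv_neg, mul_neg]

/-- **The local condition.** If `[d]_v ∈ γ_v(A(E))` for a `ℚ`-field `E` (a completion `ℚ_v`), then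
`ξ_d` restricts to zero in `H¹(E, B(Ē))`: the restricted cocycle `τ ↦ χ_d(τ) T` is the coboundary
of a point `a ∈ B(Ē)` — `a = O` if `d ∈ E²`; `a` a `2`-torsion point `(8m + 2ρ, …)`,
`ρ = w/√d`, if `[d] = [m(16m+1)] = γ(T₁)` (`m(16m+1) d = w²`); and `a = Q(μ)`, `μ = w/√d`, the
`g`-preimage of `P = (x₀, y₀)` if `[d] = [x₀] = γ(P)` (`x₀ d = w²`), using `τ a = a` or
`τ a = a + T` according to `χ_d(τ)` (compatibility of diagram (4) with localisation: the map
`S(A/gB) → Ш(B, ℚ)_g` of (9)). [cite: Kramer1983, §3 (4) and §5 (9) (definition of S(A/gB))] -/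
theorem kramerXi_mem_localRestrictionKer (hm : 0 < m) {d : ℚ} (hd : d ≠ 0)
    (hE : sqClass (algebraMap ℚ E d) ∈ Set.range (kramerGamma ((m : ℕ) : E))) :
    kramerXi hm hd ∈ (kramerCurveB (m : ℚ)).localRestrictionKer E := by
  -- notation (the terms involving the `ℚ`-algebra `Ē` are named before any `CharZero Ē` is in scope)
  set ι := closureEmb (K := ℚ) E with hιdef
  set s : AlgebraicClosure E := ι (kramerRoot d) with hsdef
  set dE : E := algebraMap ℚ E d with hdEdef
  have hW := kramerCurveB_baseChange m (AlgebraicClosure E)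
  have hWA : (kramerCurveA ((m : ℕ) : E)).baseChange (AlgebraicClosure E) =
      kramerCurveA ((m : ℕ) : AlgebraicClosure E) := by
    rw [WeierstrassCurve.baseChange, map_kramerCurveA, map_natCast]
  have hιinj : Function.Injective ι := ι.toRingHom.injective
  haveI : CharZero E := charZero_of_injective_algebraMap (algebraMap ℚ E).injective
  haveI : CharZero (AlgebraicClosure E) :=
    charZero_of_injective_algebraMap (algebraMap E (AlgebraicClosure E)).injective
  have hdE : dE ≠ 0 := by rw [hdEdef]; exact (map_ne_zero_iff _ (algebraMap ℚ E).injective).mpr hd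
  have hs2 : s * s = algebraMap E (AlgebraicClosure E) dE := by
    rw [hsdef, ← map_mul, kramerRoot_mul_self, show algebraMap ℚ (AlgebraicClosure ℚ) d = (d : AlgebraicClosure ℚ)
      from eq_ratCast _ d, map_ratCast, hdEdef, show algebraMap ℚ E d = (d : E) from eq_ratCast _ d, map_ratCast]
  have hs0 : s ≠ 0 := by
    rw [hsdef]; exact (map_ne_zero_iff _ hιinj).mpr (kramerRoot_ne_zero hd)
  have hmĒ := kramer_hm_cast hm (AlgebraicClosure E)
  have hmE := kramer_hm_cast hm E
  -- the fix condition, transported along `ι`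
  have hfixiff : ∀ τ : Field.absoluteGaloisGroup E,
      galEquiv (resGal (K := ℚ) E τ) (kramerRoot d) = kramerRoot d ↔ galEquivE E τ s = s := by
    intro τ
    rw [hsdef, ← closureEmb_galEquiv_resGal]
    exact ⟨fun h => by rw [h], fun h => hιinj h⟩
  have hnotfix : ∀ τ : Field.absoluteGaloisGroup E, galEquivE E τ s = -s → ¬ galEquivE E τ s = s :=
    fun τ hτ h => hs0 (CharZero.neg_eq_self_iff.mp (hτ.symm.trans h))
  -- the cocycle criterion
  unfold kramerXi WeierstrassCurve.localRestrictionKer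
  rw [oneCocycleClass_mem_resKer_iff]
  -- the value of the restricted cocycle
  have hval : ∀ τ : Field.absoluteGaloisGroup E,
      pointsMap (kramerCurveB (m : ℚ)) E ((kramerPhi hm hd).1 (resGal (K := ℚ) E τ)) =
        if galEquivE E τ s = s then 0 else
          (show localPoints (kramerCurveB (m : ℚ)) E from Point.some (-1 / 4) (1 / 8) (nonsingular_TE hm)) := by
    intro τ
    rw [kramerPhi_apply, kramerPhiFun]
    by_cases h : galEquivE E τ s = s
    · rw [if_pos ((hfixiff τ).mpr h), if_pos h, _root_.map_zero]
    · rw [if_neg (fun h' => h ((hfixiff τ).mp h')), if_neg h, pointsMap_kramerTgeom]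
  simp_rw [hval]
  set TE : localPoints (kramerCurveB (m : ℚ)) E := Point.some (-1 / 4) (1 / 8) (nonsingular_TE hm) with hTEdef
  -- if every `τ` fixes `s`, `a = O` works
  have all_fix : (∀ τ : Field.absoluteGaloisGroup E, galEquivE E τ s = s) →
      ∃ a : localPoints (kramerCurveB (m : ℚ)) E, ∀ τ : Field.absoluteGaloisGroup E,
        (if galEquivE E τ s = s then (0 : localPoints (kramerCurveB (m : ℚ)) E) else TE) = τ • a - a := by
    intro h
    exact ⟨0, fun τ => by rw [if_pos (h τ), smul_zero, sub_zero]⟩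
  -- case analysis on the witnessing point of `A(E)`
  obtain ⟨P, hP⟩ := hE
  rcases P with _ | ⟨x₀, y₀, h₀⟩
  · -- `P = O`: `d` is a square in `E`, so every `τ` fixes `s`
    rw [← WeierstrassCurve.Affine.Point.zero_def, kramerGamma_apply_zero] at hP
    obtain ⟨w, hw⟩ := (sqClass_eq_one_iff hdE).mp hP.symm
    refine all_fix fun τ => ?_
    have hsw : s = algebraMap E _ w ∨ s = -algebraMap E _ w := by
      rw [← mul_self_eq_mul_self_iff, hs2, hw, map_pow, pow_two]
    rcases hsw with h | h <;> rw [h]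
    · exact AlgEquiv.commutes _ w
    · rw [map_neg, AlgEquiv.commutes]
  · by_cases hx0 : x₀ = 0
    · -- `P = T₁ = (0, 0)`: `[d] = [m(16m+1)]`; `a` is a `2`-torsion point of `B(Ē)`
      subst hx0
      rw [kramerGamma_apply_some_eq _ _ rfl,
        show (0 - -(4 * ((m : ℕ) : E))) * (0 - -(16 * ((m : ℕ) : E) + 1) / 4) =
          ((m : ℕ) : E) * (16 * ((m : ℕ) : E) + 1) by ring] at hP
      obtain ⟨w, hw⟩ := exists_mul_eq_sq_of_sqClass_eq hmE hdE hP
      obtain ⟨hρ2', hρfix, hρmov⟩ := root_ratio hdE hs2 hw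
      set ρ : AlgebraicClosure E := algebraMap E (AlgebraicClosure E) w * s⁻¹ with hρdef
      have hρ2 : ρ ^ 2 = ((m : ℕ) : AlgebraicClosure E) * (16 * ((m : ℕ) : AlgebraicClosure E) + 1) := by
        rw [hρ2']; simp only [map_mul, map_add, map_one, map_natCast, map_ofNat]
      have hEq := equation_twoTorsion hρ2
      have hXne := twoTorsion_X_ne hρ2
      have hns := nonsingular_of_equation_of_eq hW hmĒ hEq
      have h₃ := nonsingular_tr_of_eq hW hmĒ hns hXne
      obtain ⟨a, hadef⟩ : ∃ a : localPoints (kramerCurveB (m : ℚ)) E, a =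
          (show localPoints (kramerCurveB (m : ℚ)) E from
            Point.some (8 * ((m : ℕ) : AlgebraicClosure E) + 2 * ρ)
              (-(8 * ((m : ℕ) : AlgebraicClosure E) + 2 * ρ) / 2) hns) := ⟨_, rfl⟩
      have e1 : a + TE = (show localPoints (kramerCurveB (m : ℚ)) E from Point.some _ _ h₃) := by
        rw [hadef, hTEdef]; exact some_add_T_of_eq hW hmĒ hns hXne _ h₃
      refine ⟨a, fun τ => ?_⟩
      rcases galEquivE_root τ hs2 with hτ | hτ
      · -- `τ` fixes `√d`: `τ a = a`
        have hτρ : galEquivE E τ ρ = ρ := hρfix τ hτ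
        have e : τ • a = a := by
          rw [hadef, smul_localPoints_some τ hns (nonsingular_galEquivE τ hns)]
          exact Point_some_ext
            (by simp only [map_add, map_mul, map_ofNat, map_natCast, hτρ])
            (by simp only [map_div₀, map_neg, map_add, map_mul, map_ofNat, map_natCast, hτρ])
        rw [if_pos hτ, e, sub_self]
      · -- `τ` moves `√d`: `τ a = a + T`
        have hτρ : galEquivE E τ ρ = -ρ := hρmov τ hτ
        have e : τ • a = a + TE := by
          rw [e1, hadef, smul_localPoints_some τ hns (nonsingular_galEquivE τ hns)]
          exact Point_some_ext
            (by simp only [map_add, map_mul, map_ofNat, map_natCast, hτρ]; rw [kramerTrX_of_twoTorsion hρ2]; ring)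
            (by simp only [map_div₀, map_neg, map_add, map_mul, map_ofNat, map_natCast, hτρ];
                rw [kramerTrY_of_twoTorsion hρ2]; ring)
        rw [if_neg (hnotfix τ hτ), e, add_sub_cancel_left]
    · -- generic `P = (x₀, y₀)`: `[d] = [x₀]`; `a = Q(μ)`, `μ = w/√d`
      rw [kramerGamma_apply_some_ne _ _ hx0, sub_zero] at hP
      obtain ⟨w, hw⟩ := exists_mul_eq_sq_of_sqClass_eq hx0 hdE hP
      obtain ⟨hμ2, hμfix, hμmov⟩ := root_ratio hdE hs2 hw
      set μ : AlgebraicClosure E := algebraMap E (AlgebraicClosure E) w * s⁻¹ with hμdef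
      obtain ⟨mĒ, hmĒdef⟩ : ∃ mĒ : AlgebraicClosure E, mĒ = ((m : ℕ) : AlgebraicClosure E) := ⟨_, rfl⟩
      obtain ⟨x₀', hx₀'def⟩ : ∃ x₀' : AlgebraicClosure E, x₀' = algebraMap E (AlgebraicClosure E) x₀ := ⟨_, rfl⟩
      obtain ⟨y₀', hy₀'def⟩ : ∃ y₀' : AlgebraicClosure E, y₀' = algebraMap E (AlgebraicClosure E) y₀ := ⟨_, rfl⟩
      rw [← hx₀'def] at hμ2
      rw [← hmĒdef] at hWA hmĒ hW
      have hx₀' : x₀' ≠ 0 := by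
        rw [hx₀'def]; exact (map_ne_zero_iff _ (algebraMap E (AlgebraicClosure E)).injective).mpr hx0
      have hμ0 : μ ≠ 0 := by
        intro h; apply hx₀'; rw [← hμ2, h, zero_pow two_ne_zero]
      -- the `A`-equation over `Ē`
      have hA' : (kramerCurveA mĒ).toAffine.Equation x₀' y₀' := by
        have hinj : Function.Injective (Algebra.ofId E (AlgebraicClosure E)) :=
          (algebraMap E (AlgebraicClosure E)).injective
        have h1 := ((kramerCurveA ((m : ℕ) : E)).toAffine.baseChange_equation hinj x₀ y₀).mpr h₀.left
        rw [show (kramerCurveA ((m : ℕ) : E)).toAffine.baseChange (AlgebraicClosure E) =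
          kramerCurveA mĒ from hWA] at h1
        rw [hx₀'def, hy₀'def]
        exact h1
      have hden := kramerQden_ne_zero hA' hμ2 hx₀'
      have hEq := equation_kramerQ hA' hμ2 hx₀'
      have hXne := kramerQX_ne hμ0 hden
      have hns := nonsingular_of_equation_of_eq hW hmĒ hEq
      have h₃ := nonsingular_tr_of_eq hW hmĒ hns hXne
      obtain ⟨a, hadef⟩ : ∃ a : localPoints (kramerCurveB (m : ℚ)) E, a =
          (show localPoints (kramerCurveB (m : ℚ)) E from
            Point.some (kramerQX mĒ x₀' y₀' μ) (kramerQY mĒ x₀' y₀' μ) hns) := ⟨_, rfl⟩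
      have e1 : a + TE = (show localPoints (kramerCurveB (m : ℚ)) E from Point.some _ _ h₃) := by
        rw [hadef, hTEdef]; exact some_add_T_of_eq hW hmĒ hns hXne _ h₃
      have hτm : ∀ τ : Field.absoluteGaloisGroup E, galEquivE E τ mĒ = mĒ := fun τ => by
        rw [hmĒdef, map_natCast]
      have hτx : ∀ τ : Field.absoluteGaloisGroup E, galEquivE E τ x₀' = x₀' := fun τ => by
        rw [hx₀'def, AlgEquiv.commutes]
      have hτy : ∀ τ : Field.absoluteGaloisGroup E, galEquivE E τ y₀' = y₀' := fun τ => by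
        rw [hy₀'def, AlgEquiv.commutes]
      refine ⟨a, fun τ => ?_⟩
      rcases galEquivE_root τ hs2 with hτ | hτ
      · -- `τ` fixes `√d`: `τ a = a`
        have hτμ : galEquivE E τ μ = μ := hμfix τ hτ
        have e : τ • a = a := by
          rw [hadef, smul_localPoints_some τ hns (nonsingular_galEquivE τ hns)]
          exact Point_some_ext (by rw [map_kramerQX, hτm, hτx, hτy, hτμ])
            (by rw [map_kramerQY, hτm, hτx, hτy, hτμ])
        rw [if_pos hτ, e, sub_self]
      · -- `τ` moves `√d`: `τ a = Q(−μ) = a + T`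
        have hτμ : galEquivE E τ μ = -μ := hμmov τ hτ
        have e : τ • a = a + TE := by
          rw [e1, hadef, smul_localPoints_some τ hns (nonsingular_galEquivE τ hns)]
          exact Point_some_ext
            (by rw [map_kramerQX, hτm, hτx, hτy, hτμ, kramerTrX_kramerQX hA' hμ2 hx₀'])
            (by rw [map_kramerQY, hτm, hτx, hτy, hτμ, kramerTrY_kramerQ hA' hμ2 hx₀'])
        rw [if_neg (hnotfix τ hτ), e, add_sub_cancel_left]

end Local

/-! ### Discharge of `Kramer1983_shaG_of_selmerG` -/

/-- Every element of `Additive (ℚ*/ℚ*²)` is killed by `2`. [folklore] -/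
theorem two_nsmul_additive_sqUnits (x : Additive (SqUnits ℚ)) : 2 • x = 0 := by
  have h : Additive.toMul x * Additive.toMul x = 1 := SqUnits.mul_self _
  rw [two_nsmul]
  change Additive.ofMul (Additive.toMul x * Additive.toMul x) = 0
  rw [h]
  rfl

end KramerShaG

open KramerShaG in
/-- **Kramer 1983, §3 (4) and §5 (9)–(10) — the leaf `Kramer1983_shaG_of_selmerG` PROVED.** The
homomorphism `Ξ : ℚ*/ℚ*² = H¹(ℚ, B_g) → H¹(ℚ, B)`, `[d] ↦ ξ_d = [σ ↦ χ_d(σ) T]`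
(`KramerShaG.kramerXiHom`), has values killed by `2`, kernel inside `γ(A(ℚ))`
(`KramerShaG.sqClass_mem_range_of_kramerXi_eq_zero`: a dying class is the coboundary of some
`v ∈ B(ℚ̄)`, and `g(v) ∈ A(ℚ)` has `γ(g(v)) = [d]`), and sends a class satisfying the local
condition at a place into the local kernel there (`KramerShaG.kramerXi_mem_localRestrictionKer`:
explicit local `g`-preimages). [cite: Kramer1983, §3 (4), §5 (9)–(10) and Lemma 3] -/
theorem Kramer1983_shaG_of_selmerG_holds : Kramer1983_shaG_of_selmerG := by
  intro m hm
  refine ⟨kramerXiHom hm, fun x => ?_, fun d hd h0 => ?_, fun d hd v hv => ?_, fun d hd w hw => ?_⟩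
  · rw [← map_nsmul, two_nsmul_additive_sqUnits, _root_.map_zero]
  · rw [kramerXiHom_sqClass hm hd] at h0
    exact sqClass_mem_range_of_kramerXi_eq_zero hm hd h0
  · rw [kramerXiHom_sqClass hm hd]
    exact kramerXi_mem_localRestrictionKer hm hd hv
  · rw [kramerXiHom_sqClass hm hd]
    exact kramerXi_mem_localRestrictionKer hm hd hw

/-- **`Kramer1983_twoRank_sha_family` from the single remaining leaf**
`Kramer1983_selmerG_generators_local` (Lemma 2 with the Remark of §4 for the generators `-1`,
`p ∈ 𝔏 ∪ 𝔐` over the completions), the other two leaves of `KramerDescent` being proved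
(`Kramer1983_shaG_of_selmerG_holds` here, `KramerTwoDescent.Kramer1983_selmerTwo_span_holds` in
`KramerDescentSelmerTwoSpanProofs`). [cite: Kramer1983, Theorem (§5)] -/
theorem Kramer1983_twoRank_sha_family_of_generators_local
    (hloc : Kramer1983_selmerG_generators_local) : Kramer1983_twoRank_sha_family :=
  KramerTwoDescent.Kramer1983_twoRank_sha_family_of_local_global hloc
    Kramer1983_shaG_of_selmerG_holds

end Literature.NumberTheory.EllipticCurves

end
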